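import Literature.MathematicalPhysics.QuantumFieldTheory.Balaban1983to89.B2Lemma24KerOmega
import Literature.MathematicalPhysics.QuantumFieldTheory.Balaban1983to89.B2Prop22RegularTorusPair

/-!
# [B2] Lemma 2.4, proof p. 572, ON THE TORUS `T_η`: the four (2.58) kernel inputs of the Lemma 2.4 family DISCHARGED for
# an outer region `Ω = B^k(Λ₂^{(k−1)′}) ⊂ T_η` that may wrap around the torus — in particular for `Λ₂′ =` the whole
# unit torus — from the tree's Proposition 2.2 on TORUS region pairs (`B2Prop22RegularTorusPair.ineq258_torusPairFam`,
# `ineq258_torus_rect`), the box `□ = B^k(□₂)` being a PROPER box of the torus (`M_μ < P_μ`): the torus twin of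
# `B2Lemma24KerOmega`

statement-level skeleton of published theorems with citation tags; proofs where landed; nothing here is a claim about
the Yang–Mills mass gap

**Sources.** T. Bałaban, *(Higgs)₂,₃ quantum fields in a finite volume. II. An upper bound*, Commun. Math. Phys. **86**
(1982) 555–594 (bib key `Balaban1982Higgs2`, «B2»; held `paper:balaban1982-cmp86-higgs23-ii`, journal page = PDF page +
554; text layer `p0016.txt`–`p0018.txt` = pp. 570–572, renders
`run/shared/lean/pub/pub-balaban/b2b-balaban-ref1/pages/1982-cmp86-higgs23-II/1982-cmp86-higgs23-II-p016-x2.png`,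
`-p018-x2.png`): (2.56) p. 570, Proposition 2.2 (2.58) pp. 570–571, the sentence after (2.60) p. 571, Lemma 2.4
(2.65)–(2.67) p. 572; T. Bałaban, *Regularity and decay of lattice Green's functions*, Commun. Math. Phys. **89** (1983)
571–597 (bib key `Balaban1983RegularityDecay`, «B4»): p. 572 «operators on subsets of a torus T_η», (1.1)–(1.7)
pp. 572–573, Theorem p. 573 incl. «For some simple sets Ω, e.g. for rectangular parallelepipeds, the inequalities hold
without any restrictions on the points x, x′», §2 p. 575.  A NEW LEAF over `B2Lemma24KerOmega` (lit-balaban p23 g19,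
p340291: `boxLabels`, `eB`, `eY`, `shiftF`, `hnk`, `kerBox_mulVec_eq`, `dkerBox_mulVec_eq`, `block_mulVec_eq_fld`,
`boxEmb_add_e1`, `boxEmb_add_e1_mem`, `fieldLink_boxEmb`, `fld_regionDeriv_boxEmb`, `mem_fineDom_boxLabels_iff`,
`shift_mem_boxLabels`, `sub_mem_boxDom`, `FrameU`-style frames; `B2Lemma24SupG.{FrameS, ModelT, famOfT, κS, embS, ΓS,
AprS, A0S, thetaS, constBond_add_AprS}`, `B2Lemma24RemD.ModelR.{toModel, toModel_restr, toModel_dev}`,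
`B2Lemma24Proof.{kerBox, dkerBox, dKer, lemma24_bounds}`) and over `B2Prop22RegularTorusPair` (p23 g14, p323436:
`tsrc`, `tsrc₀`, `tbond`, `tbase`, `tldist`, `extT_tsrc`, `ineq258_torusPairFam`, `ineq258_torus_rect`); used BY NAME,
nothing restated: r01 g9 `B4TorusPairFam.{TorusPairInst, torusPairFam, tcdist, tcdist_nonneg, TorusPairInst.(GT, G₀T, DT,
deltaT, extT, resT, fld_deltaT, fld_DT_deltaT)}` (p318600), r01 g9 `B4TorusRegionOp.{per, per_pos, twrap, twrap_eq_self,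
twrap_apply, TNbr, tNbr_of_nbrs, torWt, torBond, torBond_eq_compField, perField, torusOp, torusDeriv, tcovDeriv,
fld_tcovDeriv_mulVec_of_mem, val_mem_perBox, contourTrans_tor_eq, fieldLink_tor_eq_of_nbrs, regWt_le_torWt, cdev,
cdev_nonneg, cdev_add_mul, tnorm, exists_lift_eq_tnorm}`, r01 g7 `B4RegionCubeCarrier.{boxEmb, boxEmbY, blk_boxEmb,
compField_add, fineDom_mono, incl, inclY}`, b05 `B4Sect5Proof.{latticeConst, latticeSum_le}`, b04 `B4GaugeCovariance.{b4Op,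
fld, fieldLink, contourTrans, covOp_congr}`, `B4Lemma21Region.{regionOp, regionDeriv}`, `B4Lemma22ReduceZero.Box`,
`B2Eq268GaugeAway.blkSite`, `B2Prop22RegularRegionPair.{avgQ, single, srcQ, fld_mul_avgQ_transpose_mulVec_single}`.  No
existing module is touched, no definition of record altered, nothing of [B2]/[B4] asserted as a fact.  Unit
`lit-balaban-p23` gen 19 (Phase-2 proof seat p23), 2026-08-22; SKELETON row **B2.Lem2.4** (fold owner r02, second reader
r14, referee ref-4; decl of record `B2.Lemma24Printed`); successor of `B2Lemma24KerOmega` HONEST SCOPE (a) («an `Λ₂′`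
that wraps around the torus … is NOT a member of this family; the torus twin … is successor work») — this file is that
twin.  v1.0 = p341404; v1.1 = p341920, DOCSTRING-ONLY — declarations byte-identical —: the locator of [B4] (1.7)
corrected to p. 572 (×4; r04's CITELOC audit g22); v1.2, DOCSTRING-ONLY: the [B4] p. 572 torus sentence
re-quoted verbatim («Another common case is …», r02 21:07Z) and the (2.39) locator split p. 582 / clause p. 583; v1.3 (this
text, p23 gen 20), DOCSTRING-ONLY: the (2.58) restriction locator split «Prop. 2.2 (2.58) p. 570; p. 571 «for b ⊂ Ω,
dist(b, Ω^c) ≧ R₀»» (×4; summit-lit1 CITELOC #21 class P84-005).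

## WHAT IS PRINTED (verbatim «…»)

[B2] p. 570 (2.56) [PDF 16]: «φ^{(k)} = a_kG_k(B^k(Λ₂^{(k−1)′}), A^{(k)})Q_k^*(A^{(k)})Λ₆^{(k−1)′}φ.»  Proposition 2.2,
pp. 570–571: «Let Ω and A satisfy the assumptions of Proposition I.2.1, then for e(L^kε) sufficiently small there exist
positive constants δ₀, c₀, R₀ independent of A, k, Ω and depending on d, a, M, such that
|(D^η_AG_k(Ω, A)Q_k^*(A))(b, y)| ≦ c₀ exp(−δ₀ dist(b, y)), (2.58) for b ⊂ Ω, dist(b, Ω^c) ≧ R₀, y ∈ Ω^{(k)}. The identical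
inequality holds for G_k(Ω, A)Q_k^*(A), and for D^η_AδG_k(Ω, Ω₀, A)Q_k^*(A), δG_k(Ω, Ω₀, A)Q_k^*(A) with the additional
factor exp(−δ₀(dist(b, Ω^c) + dist(y, Ω^c))).»  p. 571: «The inequality (2.60) implies that the configuration A^{(k)}
considered on the set B^k(Λ₂^{(k−1)′}) satisfies the assumption of Proposition I.2.1. on a vector field configuration.»
p. 572 [PDF 18]: «Let us define □₁, □₂ as the sums of large blocks contained in Λ₇^{(k−1)′} and distant from the point y
less than 2r(L^kε), 4r(L^kε) respectively, and let us denote □ = B^k(□₂). Of course □ ⊂ B^k(Λ₂^{(k−1)′}). Using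
Proposition 2.2 and the restrictions (2.55) we get φ^{(k)}(x) = (a_kG_k(□, A^{(k)})Q_k^*(A^{(k)})□₁φ)(x) + O((L^kε)^κ),
x ∈ B^k(y), (2.67) and the same equality for the covariant derivative of φ^{(k)}.»  [B4] p. 572 [PDF 2, L4–6]:
«Another common case is to consider operators on subsets of a torus T_η which we identify with a rectangular
parallelepiped in ηZ^d with periodic conditions.»  [B4] p. 573, after the Theorem: «For some simple sets Ω, e.g. for rectangular parallelepipeds, the
inequalities hold without any restrictions on the points x, x′».  [B4] p. 575: «We have assumed that Ω^{(k)} is a sum of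
large blocks, i.e. blocks of the size M on the unit lattice, thus Ω is a sum of the corresponding large blocks of the
size M on η-lattice T_η.»

## DICTIONARY

As in `B2Lemma24KerOmega` (its §§1–2 are imported), with the torus in place of `ηℤ^{d+1}`: the torus
`T_η = Π_ν ℤ/(L^kP_ν)` of r01's `TorusPairInst` (`P_ν ≥ 1` unit blocks per direction, fine period `L^kP_ν ≥ 3`, labels =
representatives in the period box `Π_ν[0, P_ν)`); the outer region `Ω = B^k(Λ₂′)` = a union of big blocks of the torus,
given by its unit labels `Ω₀T ⊆ Π_ν[0,P_ν)`, ALLOWED TO WRAP AROUND `T_η` and to be all of it; the box `□₂ = o + [0, M)`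
a PROPER box of the torus, `0 ≤ o_μ`, `o_μ + M_μ ≤ P_μ`, `M_μ < P_μ` (so that no torus bond of `□ = B^k(□₂)` wraps and
the torus operator (1.6) of `□` IS the lattice operator of the box lineage at the periodic field, `torusOp_eq_regionOp`);
`A^{(k)}` = a torus component field `Ac` (read on the period box, periodic extension `perField`), (1.7)-regular ON `Ω`
with the torus forward differences; the field fed to the box lineage is `A^{(k)}_per(· + L^ko)` (`shiftF … (perField …)`);
`K_Ω(x, y′) := a_k·(G_k(Ω, A)Q_k^*(A))(x + L^ko, y′)` over r01's TORUS Green's function `TorusPairInst.GT`; the label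
distance is the unit TORUS distance `|y(x) + o − y′|_{T_1}` (`tnorm 1 P`); `dist(b, y)`, `dist(b, Ω^c)` of (2.58) are
the torus sup-distances `tldist`, `tcdist` of `B2Prop22RegularTorusPair`/`B4TorusPairFam`.  The plain clauses of (2.58)
on `Ω` come from `ineq258_torusPairFam` when `Ω ≠ T_η` (the restriction `dist_T(x, Ω^c) ≥ R₀` from the depth of `B^k(y)`
in `□`) and from `ineq258_torus_rect` when `Ω = T_η` ([B4] p. 573: no restriction on the points); the `δG_k(□, Ω, A)`
clauses from `ineq258_torusPairFam` on the torus pair `□ ⊂ Ω`.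

## Main definitions and results

* §1 `boxLabels_subset_boxDom`, `tNbr_iff_nbrs`, `torWt_eq_regWt`, **`torusOp_eq_regionOp`** (the torus operator (1.6)
  of a proper box = the lattice operator at the periodic field), `avgQ_tor_eq`, `exists_torus_pt_off_box`.
* §2 `fld_torusDeriv_boxEmb` (the torus derivative (1.3) along a bond of the embedded box).
* §3 torus distances: `le_tcdist`, `cdev_window`, `cdev_scale`, `tnorm_label_le`, `deep_tnorm_le`,
  **`torus_latticeSum_le`** (`Σ_{y′ ∈ T} e^{−a|b−y′|_{T_1}} ≤ K_{d+1}(a)`, by nearest lifts and b05's `latticeSum_le`).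
* §4 the constants `dT, cT, rT, eT` of `ineq258_torusPairFam` and `dR, cR, eR` of `ineq258_torus_rect` (`choose`),
  `T_spec`, `R_spec`; `FrameV` (a `FrameS` whose `cO, δO, SO` dominate them), `FrameV.ofFrameS`.
* §5 `ModelV` (the instance with its torus, outer region and torus field; NO kernel hypothesis field), `KΩT`, `dLT`,
  the identities `KΩT_mulVec`, `KΩT_sub_kerBox_mulVec`, `dKer_KΩT_mulVec`, `dKer_sub_dkerBox_mulVec`, the theorems
  **`kerΩ_far`, `kerΩ_near`, `dkerΩ_far`, `dkerΩ_near`, `summableΩ`**, `toModelT : ModelT fr.toFrameS ↥Ω₀T`, `famOfV`,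
  **`lemma24Printed_modelV (fr : FrameV ι d) : B2.Lemma24Printed (famOfV fr)`**.

## HONEST SCOPE

(a) CARRIER: `Ω = B^k(Λ₂^{(k−1)′})` = any union of big blocks of the torus `T_η = Π_ν ℤ/(L^kP_ν)` of r01's
`torusPairFam` (fine period `≥ 3`, `Kmod ∣ P_ν`), INCLUDING the whole torus; `□₂` a proper box (`M_μ < P_μ` — print's
`□₂` has diameter `8r(L^kε) ≪` the torus side).  Distances in the torus sup-metric, unit-lattice units.  (b) SUB-FAMILY
as in `B2Lemma24SupG`/`B2Lemma24KerOmega` HONEST SCOPE: staircase contours, charge `e/L^k`, component field; (2.23)/(1.7)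
ON `Ω` with torus forward differences.  (c) WHAT REMAINS a hypothesis field of `ModelV`: NOTHING OF ESTIMATE SHAPE —
data; the geometry `hbox`/`ho0`/`hoP`/`hMP` (`□₂ ⊂ Λ₂′`, a proper box whose representative `o + [0, M)` does not
cross the seam of the period box — for `M_μ < P_μ` always arranged by a translation of `T_η`, under which [B4]
(1.1)–(1.12) are invariant; that translation is NOT performed in the kernel), `hbigΩ`/`hbigB`/`hKP` (big-block unions,
`Kmod ∣ P_ν`), `deep` with `hRT`/`hR4`/`hR1`, `far1`, `inc_mem`, `farΩ` (torus label distance `≥ R₂` off `□₁`), `hMS`,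
`hM3` (`P_ν ≥ 1` and the fine period `≥ 3` of r01's family are CONSEQUENCES, `hPT`/`h3T`); the
regularity on `Ω`; smallness of `e(L^kε)` (`hle`, `hleT`, `hleR`, `hθ1`, `hτ1`) — the thresholds `eNC1`, `eT1`, `eR1` are
`choose`s, not kernel-explicit; that print's `e(L^kε)` meets them for `ε` small is a located PROSE claim, zero head
weight —; the scale products; (2.55) via `Restr`.  The INTENDED INSTANCE is the print's own (`y ∈ Λ₇′`, the 4r/2r
cubes, `K₀ = M`), cf. `B2Eq28RegionsBigBlockUnion`, `B2Eq267HiggsRegionAsPrinted`; deriving (c) from `y ∈ Λ₇′` inside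
the kernel is NOT done here.  (d) CONSTANTS (criterion K4′ of `lit-balaban-r02/B2-CLOSURE.md` §32a): `C` = the constant
of `lemma24_bounds fr.toFrame`, a function of the fields of `fr.toFrame` alone (`d`, `ℓ`, `F`/`ℓ₁`, `a±`, `m²₊`, `cO`,
`δO`, `SO` — tied to `dT, cT, dR, cR (d, F, ℓ, a±, m²₊, c_reg, β)` and `latticeConst (d+1) (δO/2)` by `hδT`/`hcT`/`hδR`/
`hcR`/`hST` —, `c_I, r₁, r₂`, the `K`'s); it does NOT depend on the torus `P`, the region `Ω₀T`/`|Tout|` (the volume),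
`k`, `M`, `S`, `A`, `φ`, `e`, base points; those enter only thresholds.  (e) `Model`, `ModelR`, `ModelS`, `ModelT`
untouched.  (f) Kernel-block reading of (2.58) as in p23 g14.  Value = the Lemma 2.4 family of record reaches the
torus carrier of [B2] with all four (2.58) inputs PROVED; NOT summit progress.
-/

namespace Literature.MathematicalPhysics.QuantumFieldTheory.Balaban1983to89.B2Lemma24KerOmegaTorus

open Finset Matrix
open Literature.MathematicalPhysics.QuantumFieldTheory.Balaban1983to89.B4GaugeCovariance
open Literature.MathematicalPhysics.QuantumFieldTheory.Balaban1983to89.B4Lower18 (fineDom mem_fineDom IsBlockUnion)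
open Literature.MathematicalPhysics.QuantumFieldTheory.Balaban1983to89.B4Lower18Regular (e1 lsum baseEmb stairContour
  base_le_of_blk)
open Literature.MathematicalPhysics.QuantumFieldTheory.Balaban1983to89.B4Lower18RegularRegion (regWt rBlkWt rbaseEmb
  rstairContour compField covOp_congr)
open Literature.MathematicalPhysics.QuantumFieldTheory.Balaban1983to89.B4Lemma21Region (siteNorm regionOp regionDeriv
  covDeriv fld_covDeriv_mulVec_of_mem)
open Literature.MathematicalPhysics.QuantumFieldTheory.Balaban1983to89.B4Reflection242 (nbrs mem_nbrs boxDom mem_boxDom blk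
  blk_mem_boxDom)
open Literature.MathematicalPhysics.QuantumFieldTheory.Balaban1983to89.B4ContourShift (supNorm supNorm_nonneg
  exists_supNorm_eq abs_le_supNorm)
open Literature.MathematicalPhysics.QuantumFieldTheory.Balaban1983to89.B4Lemma22Reduce231 (supN siteNorm_nonneg siteNorm_smul
  siteNorm_zero)
open Literature.MathematicalPhysics.QuantumFieldTheory.Balaban1983to89.B4Lemma22ReduceZero (Box)
open Literature.MathematicalPhysics.QuantumFieldTheory.Balaban1983to89.B4RegionCubeCarrier (boxEmb boxEmbY boxEmb_injective
  boxEmbY_injective blk_boxEmb compField_add incl inclY)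
open Literature.MathematicalPhysics.QuantumFieldTheory.Balaban1983to89.B4Eq221L2FactorRegion (acBond)
open Literature.MathematicalPhysics.QuantumFieldTheory.Balaban1983to89.B4TorusRegionOp
open Literature.MathematicalPhysics.QuantumFieldTheory.Balaban1983to89.B4TorusPairFam
open Literature.MathematicalPhysics.QuantumFieldTheory.Balaban1983to89.B2Eq268GaugeAway
open Literature.MathematicalPhysics.QuantumFieldTheory.Balaban1983to89.B2Lemma24Proof
open Literature.MathematicalPhysics.QuantumFieldTheory.Balaban1983to89.B2Lemma24RemD
open Literature.MathematicalPhysics.QuantumFieldTheory.Balaban1983to89.B2Lemma24SupG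
open Literature.MathematicalPhysics.QuantumFieldTheory.Balaban1983to89.B2Lemma24KerOmega
open Literature.MathematicalPhysics.QuantumFieldTheory.Balaban1983to89.B2Prop22RegularRegionPair (avgQ single srcQ
  fld_mul_avgQ_transpose_mulVec_single srcQ_smul)
open Literature.MathematicalPhysics.QuantumFieldTheory.Balaban1983to89.B2Prop22RegularTorusPair (tsrc tsrc₀ tbond tbase
  tldist extT_tsrc ineq258_torusPairFam ineq258_torus_rect one_le_nT)

noncomputable section

variable {d : ℕ} {ι : Type} [Fintype ι] [DecidableEq ι]

/-! ## §1 A proper box of the torus: no torus bond of the box wraps; the torus operator of the box is the lattice one -/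

section Proper

variable {n : ℕ} (hn : 1 ≤ n) {P : Fin (d + 1) → ℕ} (h3 : ∀ ν, 3 ≤ per n P ν) {M : Fin (d + 1) → ℕ}
  {o : Fin (d + 1) → ℤ} (ho0 : ∀ i, 0 ≤ o i) (hoP : ∀ i, o i + M i ≤ P i) (hMP : ∀ i, M i < P i)

omit [Fintype ι] [DecidableEq ι] in
include ho0 hoP in
/-- a box of labels inside the period box (`0 ≤ o`, `o + M ≤ P`). [cite: Balaban1983RegularityDecay, p. 572 «a rectangular parallelepiped … with periodic conditions», dictionary] -/
theorem boxLabels_subset_boxDom : boxLabels M o ⊆ boxDom P := by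
  intro y hy
  rw [mem_boxDom]
  intro i
  obtain ⟨h1, h2⟩ := (mem_boxLabels.1 hy) i
  exact ⟨(ho0 i).trans h1, by have := hoP i; omega⟩

omit [Fintype ι] [DecidableEq ι] in
include hn ho0 hoP hMP in
/-- **NO TORUS BOND OF A PROPER BOX WRAPS**: for two fine sites of the box `□ = B^k(□₂ + o)` with `M_μ < P_μ` in every
direction, torus nearest neighbours are lattice nearest neighbours. [cite: Balaban1983RegularityDecay, (1.3) p. 572 «bonds …
with end-points in Ω», p. 572 «periodic conditions», dictionary] -/
theorem tNbr_iff_nbrs {u v : Fin (d + 1) → ℤ} (hu : u ∈ fineDom n (boxLabels M o)) (hv : v ∈ fineDom n (boxLabels M o)) :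
    TNbr n P u v ↔ v ∈ nbrs u := by
  have hsub := boxLabels_subset_boxDom (M := M) ho0 hoP
  have hn0 : (0 : ℤ) < n := by exact_mod_cast hn
  -- the key step: a forward step from a site of the box that stays in the box never wraps
  have key : ∀ {u v : Fin (d + 1) → ℤ}, u ∈ fineDom n (boxLabels M o) → v ∈ fineDom n (boxLabels M o) →
      ∀ μ, v = twrap n P (u + e1 μ) → v = u + e1 μ := by
    intro u v hu hv μ h
    have hub := (mem_fineDom_boxLabels_iff M o hn u).1 hu
    have hvb := (mem_fineDom_boxLabels_iff M o hn v).1 hv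
    by_cases hin : u + e1 μ ∈ boxDom (per n P)
    · rw [twrap_eq_self hin] at h; exact h
    · -- `u + e_μ` leaves the period box: then `u_μ = nP_μ − 1`, `v_μ = 0`, forcing `M_μ = P_μ`
      exfalso
      have hu' : u ∈ boxDom (per n P) := val_mem_perBox hn hsub ⟨u, hu⟩
      rw [mem_boxDom] at hin hu'
      push Not at hin
      obtain ⟨i, hi⟩ := hin
      have hiμ : i = μ := by
        by_contra hne
        have : (u + e1 μ) i = u i := by simp [e1, hne]
        rw [this] at hi
        exact absurd (hu' i).2 (not_lt.2 (hi (hu' i).1))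
      subst hiμ
      have hui : (u + e1 i) i = u i + 1 := by simp [e1]
      rw [hui] at hi
      have htop : u i + 1 = (per n P i : ℤ) := by
        have := (hu' i).2; have := hi (by linarith [(hu' i).1]); omega
      -- `v_i = (u_i + 1) mod nP_i = 0`
      have hvi : v i = 0 := by
        have := congrFun h i
        rw [twrap_apply, hui, htop, Int.emod_self] at this
        exact this
      -- box constraints
      have h1 := (hvb i).1
      rw [hvi] at h1
      have h2 := (hub i).2
      have hoi : o i = 0 := le_antisymm (by nlinarith [ho0 i]) (ho0 i)
      have hper : ((per n P i : ℕ) : ℤ) = (n : ℤ) * P i := by simp [per]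
      rw [hper] at htop
      have : (n : ℤ) * P i ≤ (n : ℤ) * (o i + M i) := by linarith
      have hPM : (P i : ℤ) ≤ o i + M i := le_of_mul_le_mul_left this hn0
      have := hMP i
      omega
  constructor
  · rintro ⟨μ, h | h⟩
    · rw [key hu hv μ h]; exact mem_nbrs.2 ⟨μ, Or.inl rfl⟩
    · have := key hv hu μ h
      rw [this]
      exact mem_nbrs.2 ⟨μ, Or.inr (by simp [e1])⟩
  · intro h
    exact tNbr_of_nbrs (ΩT := boxLabels M o) hn hsub (u := ⟨u, hu⟩) (v := ⟨v, hv⟩) h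

omit [Fintype ι] [DecidableEq ι] in
include hn ho0 hoP hMP in
/-- **the torus bond weights of a proper box are the lattice Neumann weights**. [cite: Balaban1983RegularityDecay, (1.3) p. 572, dictionary] -/
theorem torWt_eq_regWt : torWt n P (fineDom n (boxLabels M o)) = regWt n (fineDom n (boxLabels M o)) := by
  funext u v
  unfold torWt regWt
  by_cases h : v.1 ∈ nbrs u.1
  · rw [if_pos h, if_pos ((tNbr_iff_nbrs hn ho0 hoP hMP u.2 v.2).2 h)]
  · rw [if_neg h, if_neg (fun h' => h ((tNbr_iff_nbrs hn ho0 hoP hMP u.2 v.2).1 h'))]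

include h3 ho0 hoP hMP in
/-- **THE TORUS OPERATOR (1.6) OF A PROPER BOX IS THE LATTICE OPERATOR AT THE PERIODIC FIELD**:
`H^T_k(□, A) = H^{ℤ}_k(□, A^per)` — no bond of `□` wraps, the transporters run inside unit blocks; so the torus Green's
function `G_k(□, A)` of [B2] p. 572 «□ = B^k(□₂)» IS the box lineage's. [cite: Balaban1983RegularityDecay, (1.3)–(1.6)
p. 572 «operators on subsets of a torus T_η»; Balaban1982Higgs2, (2.67) p. 572] -/
theorem torusOp_eq_regionOp (F : OrthFlow ι) (e a m2 : ℝ) (Ac : (Fin (d + 1) → ℤ) → Fin (d + 1) → ℝ) :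
    torusOp F e hn a m2 P (boxLabels M o) Ac = regionOp F e hn a m2 (boxLabels M o) (perField n P Ac) := by
  have hsub := boxLabels_subset_boxDom (M := M) ho0 hoP
  rw [torusOp, regionOp, b4Op, b4Op, torWt_eq_regWt hn ho0 hoP hMP, contourTrans_tor_eq F hn h3 hsub]
  refine covOp_congr _ _ (fun x y hc => ?_) (fun _ _ _ => rfl)
  have hxy : y.1 ∈ nbrs x.1 := by
    by_contra hne
    apply hc
    unfold regWt
    rw [if_neg hne, mul_zero]
  exact fieldLink_tor_eq_of_nbrs F hn h3 hsub _ Ac hxy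

include hn h3 in
/-- **`Q_k(A)` OF A TORUS REGION IS `Q_k(A^per)` OF ITS FUNDAMENTAL DOMAIN**: the block transporters of the torus bonds are
those of the periodic field (r01's `contourTrans_tor_eq`). [cite: Balaban1983RegularityDecay, (1.4) p. 572 «U(A(Γ^{(k)}_{y,x}))»] -/
theorem avgQ_tor_eq (F : OrthFlow ι) (κ : ℝ) {ΩT : Finset (Fin (d + 1) → ℤ)} (hΩ : ΩT ⊆ boxDom P)
    (Ac : (Fin (d + 1) → ℤ) → Fin (d + 1) → ℝ) :
    avgQ F κ hn ΩT (fun u v : ↥(fineDom n ΩT) => torBond n P Ac u.1 v.1) = avgQ F κ hn ΩT (acBond ΩT (perField n P Ac)) := by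
  unfold avgQ
  rw [contourTrans_tor_eq F hn h3 hΩ]

omit [Fintype ι] [DecidableEq ι] in
include hn ho0 hMP in
/-- **A PROPER BOX IS NOT THE WHOLE TORUS**: some fine torus point lies off `B^k(□₂ + o)` (so `dist_T(·, □^c)` is a genuine
infimum). [cite: Balaban1983RegularityDecay, Theorem p. 573 «dist(x, Ω^c) ≥ R₀», dictionary] -/
theorem exists_torus_pt_off_box : (boxDom (per n P) \ fineDom n (boxLabels M o)).Nonempty := by
  have hn0 : (0 : ℤ) < n := by exact_mod_cast hn
  -- the label `w` with `w_i = M_i` where `o_i = 0` and `w_i = 0` elsewhere lies in the period box, off `□₂ + o`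
  set w : Fin (d + 1) → ℤ := fun i => if o i = 0 then (M i : ℤ) else 0 with hw
  refine ⟨fun i => (n : ℤ) * w i, Finset.mem_sdiff.2 ⟨?_, ?_⟩⟩
  · rw [mem_boxDom]
    intro i
    have hMPi := hMP i
    have hwi : 0 ≤ w i ∧ w i < P i := by
      simp only [hw]
      split_ifs with h
      · exact ⟨by positivity, by exact_mod_cast hMPi⟩
      · exact ⟨le_rfl, by exact_mod_cast (lt_of_le_of_lt (Nat.zero_le _) hMPi)⟩
    refine ⟨by nlinarith [hwi.1], ?_⟩
    simp only [per]; push_cast; nlinarith [hwi.2]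
  · rw [mem_fineDom_boxLabels_iff M o hn]
    push Not
    refine ⟨0, fun hle => ?_⟩
    simp only [hw] at hle ⊢
    split_ifs at hle ⊢ with h
    · rw [h]; nlinarith
    · exfalso
      have : 0 < o 0 := lt_of_le_of_ne (ho0 0) (Ne.symm h)
      nlinarith

end Proper

/-! ## §2 The torus derivative along a bond of an embedded box -/

section Deriv

variable (F : OrthFlow ι) (e : ℝ) (ℓ k : ℕ) (M : Fin (d + 1) → ℕ) (o : Fin (d + 1) → ℤ) {P : Fin (d + 1) → ℕ}
  (h3 : ∀ ν, 3 ≤ per ((ℓ + 1) ^ k) P ν) {ΩT : Finset (Fin (d + 1) → ℤ)} (hΩ : ΩT ⊆ boxDom P)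
  (Ac : (Fin (d + 1) → ℤ) → Fin (d + 1) → ℝ) (ho : ∀ y : ↥(boxDom M), y.1 + o ∈ ΩT)

omit [Fintype ι] [DecidableEq ι] in
include hΩ in
/-- the forward torus neighbour of an embedded site along a bond of the box is the embedded neighbour (no wrap).
[cite: Balaban1983RegularityDecay, (1.3) p. 572, dictionary] -/
theorem twrap_boxEmb_add_e1 (μ : Fin (d + 1)) (x : ↥(Box d ℓ k M)) (h : x.1 + e1 μ ∈ Box d ℓ k M) :
    twrap ((ℓ + 1) ^ k) P ((boxEmb ℓ k M o ho x).1 + e1 μ) = (boxEmb ℓ k M o ho ⟨x.1 + e1 μ, h⟩).1 := by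
  rw [boxEmb_add_e1 ℓ k M o ho μ x h]
  exact twrap_eq_self (val_mem_perBox (hnk ℓ k) hΩ _)

omit [Fintype ι] [DecidableEq ι] in
include hΩ in
/-- a bond of the box is a torus bond of the region. [cite: Balaban1983RegularityDecay, (1.3) p. 572, dictionary] -/
theorem twrap_boxEmb_add_e1_mem (μ : Fin (d + 1)) (x : ↥(Box d ℓ k M)) (h : x.1 + e1 μ ∈ Box d ℓ k M) :
    twrap ((ℓ + 1) ^ k) P ((boxEmb ℓ k M o ho x).1 + e1 μ) ∈ fineDom ((ℓ + 1) ^ k) ΩT := by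
  rw [twrap_boxEmb_add_e1 ℓ k M o hΩ ho μ x h]
  exact (boxEmb ℓ k M o ho ⟨x.1 + e1 μ, h⟩).2

include h3 hΩ in
/-- **THE TORUS DERIVATIVE (1.3) ALONG A BOND OF THE EMBEDDED BOX** is the box derivative of the translated periodic field
(no bond of the box wraps): `(D^η_{A,μ}Φ)(x + L^ko) = L^k(U(eηA_per(·+L^ko)(x, x+e_μ))Φ(x + e_μ + L^ko) − Φ(x + L^ko))`.
[cite: Balaban1983RegularityDecay, (1.3) p. 572; Balaban1982Higgs2, (2.67) p. 572 «the same equality for the covariant derivative»] -/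
theorem fld_torusDeriv_boxEmb (μ : Fin (d + 1)) (Φ : ↥(fineDom ((ℓ + 1) ^ k) ΩT) × ι → ℝ) (x : ↥(Box d ℓ k M))
    (h : x.1 + e1 μ ∈ Box d ℓ k M) :
    fld (torusDeriv F e ((ℓ + 1) ^ k) P ΩT Ac μ *ᵥ Φ) (boxEmb ℓ k M o ho x)
      = ((((ℓ + 1) ^ k : ℕ) : ℝ)) •
          (fieldLink F (B2Lemma24SupG.κS ℓ k e)
              (fun a b : ↥(Box d ℓ k M) => compField (shiftF ℓ k o (perField ((ℓ + 1) ^ k) P Ac)) a.1 b.1)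
              x ⟨x.1 + e1 μ, h⟩ *ᵥ fld Φ (boxEmb ℓ k M o ho ⟨x.1 + e1 μ, h⟩)
            - fld Φ (boxEmb ℓ k M o ho x)) := by
  have hn : 1 ≤ (ℓ + 1) ^ k := Nat.one_le_pow _ _ (Nat.succ_pos ℓ)
  set bx := boxEmb ℓ k M o ho x with hbx
  set bx' := boxEmb ℓ k M o ho ⟨x.1 + e1 μ, h⟩ with hbx'
  have hval : bx.1 + e1 μ = bx'.1 := by
    show (x.1 + _) + e1 μ = (x.1 + e1 μ) + _
    exact add_right_comm _ _ _
  have hper' : bx'.1 ∈ boxDom (per ((ℓ + 1) ^ k) P) := val_mem_perBox hn hΩ bx'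
  have hw : twrap ((ℓ + 1) ^ k) P (bx.1 + e1 μ) = bx'.1 := by rw [hval]; exact twrap_eq_self hper'
  have hmem : twrap ((ℓ + 1) ^ k) P (bx.1 + e1 μ) ∈ fineDom ((ℓ + 1) ^ k) ΩT := by rw [hw]; exact bx'.2
  rw [torusDeriv, fld_tcovDeriv_mulVec_of_mem _ _ _ _ hmem]
  have hpt : (⟨twrap ((ℓ + 1) ^ k) P (bx.1 + e1 μ), hmem⟩ : ↥(fineDom ((ℓ + 1) ^ k) ΩT)) = bx' := Subtype.ext hw
  rw [hpt]
  have hnb : bx'.1 ∈ nbrs bx.1 := by rw [← hval]; exact mem_nbrs.2 ⟨μ, Or.inl rfl⟩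
  have hlink : fieldLink F (e / (((ℓ + 1) ^ k : ℕ) : ℝ))
        (fun u v : ↥(fineDom ((ℓ + 1) ^ k) ΩT) => torBond ((ℓ + 1) ^ k) P Ac u.1 v.1) bx bx'
      = fieldLink F (B2Lemma24SupG.κS ℓ k e)
          (fun a b : ↥(Box d ℓ k M) => compField (shiftF ℓ k o (perField ((ℓ + 1) ^ k) P Ac)) a.1 b.1)
          x ⟨x.1 + e1 μ, h⟩ := by
    dsimp only [fieldLink]
    rw [torBond_eq_compField h3 Ac (val_mem_perBox hn hΩ bx) hper' hnb,
      show compField (perField ((ℓ + 1) ^ k) P Ac) bx.1 bx'.1 = compField (shiftF ℓ k o (perField ((ℓ + 1) ^ k) P Ac)) x.1 (x.1 + e1 μ)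
        from compField_add _ x.1 (x.1 + e1 μ) _]
    rfl
  rw [show (e / ↑((ℓ + 1) ^ k) : ℝ) = e / (((ℓ + 1) ^ k : ℕ) : ℝ) from rfl] at *
  rw [hlink]

end Deriv

/-! ## §3 Torus distances of a proper box: depth, label distance, lattice sums -/

section Distances

variable {n : ℕ} (hn : 1 ≤ n) {P : Fin (d + 1) → ℕ} (hP : ∀ ν, 1 ≤ P ν)

omit [Fintype ι] [DecidableEq ι] in
include hn in
/-- a lower bound on `dist_T(x, Ω^c)` from a uniform bound over the torus points outside `Ω` (nonempty complement). [cite: Balaban1983RegularityDecay, Theorem p. 573 «dist(x, Ω^c) ≥ R₀», dictionary] -/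
theorem le_tcdist {ΩT : Finset (Fin (d + 1) → ℤ)} (x : ↥(fineDom n ΩT)) {D : ℝ}
    (hne : (boxDom (per n P) \ fineDom n ΩT).Nonempty)
    (h : ∀ z ∈ boxDom (per n P), z ∉ fineDom n ΩT → D * (n : ℝ) ≤ tnorm n P (x.1 - z)) : D ≤ tcdist P x := by
  have hn0 : (0 : ℝ) < n := by exact_mod_cast hn
  unfold tcdist
  rw [dif_pos hne]
  refine Finset.le_inf' _ _ fun z hz => ?_
  rw [le_div_iff₀ hn0]
  obtain ⟨hz1, hz2⟩ := Finset.mem_sdiff.1 hz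
  exact h z hz1 hz2

omit [Fintype ι] [DecidableEq ι] in
/-- **CIRCULAR SIZE OF A RESIDUE NEAR A WINDOW**: if `a ∈ [lo + m, hi − m − 1]` and `z ∈ [0, p) ∖ [lo, hi)` with
`0 ≤ lo`, `hi ≤ p`, then `cdev p (a − z) ≥ m + 1` — the distance on the circle `ℤ/p` from a point `m`-deep in the
window to any point off the window (the arithmetic of the torus sup-metric). [cite: Balaban1983RegularityDecay, p. 572
«a torus T_η … with periodic conditions», Theorem p. 573 «dist(x, Ω^c) ≥ R₀», dictionary] -/
theorem cdev_window {p : ℕ} {lo hi a z m : ℤ} (hlo : 0 ≤ lo) (hhi : hi ≤ p) (ha1 : lo + m ≤ a) (ha2 : a + m + 1 ≤ hi)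
    (hz0 : 0 ≤ z) (hzp : z < p) (hz : z < lo ∨ hi ≤ z) (hm : 0 ≤ m) : m + 1 ≤ cdev p (a - z) := by
  have hp0 : (0 : ℤ) < p := by linarith
  unfold cdev
  rcases hz with hz | hz
  · -- `0 < a − z < p`: the residue is `a − z`
    have h1 : 0 ≤ a - z := by linarith
    have h2 : a - z < p := by linarith
    rw [Int.emod_eq_of_lt h1 h2]
    exact le_min (by linarith) (by linarith)
  · -- `−p < a − z < 0`: the residue is `a − z + p`
    have h1 : a - z < 0 := by linarith
    have h2 : -(p : ℤ) < a - z := by linarith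
    have hmod : (a - z) % (p : ℤ) = a - z + p := by
      have : (a - z + p) % (p : ℤ) = (a - z) % p := Int.add_emod_right ..
      rw [← this, Int.emod_eq_of_lt (by linarith) (by linarith)]
    rw [hmod]
    exact le_min (by linarith) (by linarith)

omit [Fintype ι] [DecidableEq ι] in
include hn in
/-- **CIRCULAR SIZE SCALES**: `n·(cdev p r − 1) ≤ cdev (np) (nr + s)` for `0 ≤ s < n` (a fine point of the block `r` against
the block label, modulo the coarse period `p` and the fine period `np`; the arithmetic behind `dist(b, y)` on `T_η` vs. the
unit torus `T_1^{(k)}`). [cite: Balaban1983RegularityDecay, p. 572 «periodic conditions»; Balaban1982Higgs2, (2.58) p. 570 «dist(b, y)», dictionary] -/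
theorem cdev_scale {p : ℕ} (hp : 1 ≤ p) (r s : ℤ) (hs0 : 0 ≤ s) (hs : s < n) :
    (n : ℤ) * (cdev p r - 1) ≤ cdev (n * p) (n * r + s) := by
  have hp0 : (0 : ℤ) < p := by exact_mod_cast hp
  have hn0 : (0 : ℤ) < n := by exact_mod_cast hn
  have hmod0 := Int.emod_nonneg r hp0.ne'
  have hmodp := Int.emod_lt_of_pos r hp0
  have hdiv := Int.mul_ediv_add_emod r p   -- p * (r / p) + r % p = r
  -- the fine residue
  have hres : (n * r + s) % ((n * p : ℕ) : ℤ) = n * (r % p) + s := by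
    have e : n * r + s = n * (r % p) + s + ((n * p : ℕ) : ℤ) * (r / p) := by push_cast; nlinarith [hdiv]
    rw [e, Int.add_mul_emod_self_left]
    exact Int.emod_eq_of_lt (by nlinarith) (by push_cast; nlinarith)
  unfold cdev
  rw [hres]
  push_cast
  refine le_min ?_ ?_
  · have : cdev p r ≤ r % p := min_le_left _ _
    unfold cdev at this
    nlinarith [min_le_left (r % ↑p) (↑p - r % ↑p)]
  · nlinarith [min_le_right (r % ↑p) (↑p - r % ↑p)]

omit [Fintype ι] [DecidableEq ι] in
include hn hP in
/-- **LABEL TORUS DISTANCE ≤ SOURCE TORUS DISTANCE + 1**: for a fine point `u` of the block `B^k(b)` and a label `z`,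
`L^k·(|b − z|_{T_1} − 1) ≤ |u − L^kz|_{T_η}` (the printed `dist(b, y)`, `y` the base corner `L^ky`, against the torus
block-label distance). [cite: Balaban1982Higgs2, (2.58) p. 570 «dist(b, y)»; Balaban1983RegularityDecay, p. 572 «periodic conditions», dictionary] -/
theorem tnorm_label_le {u b : Fin (d + 1) → ℤ} (hb : blk n u = b) (z : Fin (d + 1) → ℤ) :
    (n : ℝ) * (tnorm 1 P (b - z) - 1) ≤ tnorm n P (u - fun i => (n : ℤ) * z i) := by
  obtain ⟨hlow, hup⟩ := base_le_of_blk hn hb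
  unfold tnorm
  obtain ⟨μ, hμ⟩ := exists_supNorm_eq (fun ν => cdev (per 1 P ν) ((b - z) ν))
  rw [hμ]
  refine le_trans ?_ (abs_le_supNorm (fun ν => cdev (per n P ν) ((u - fun i => (n : ℤ) * z i) ν)) μ)
  have h1 : 0 ≤ cdev (per 1 P μ) ((b - z) μ) := cdev_nonneg (per_pos le_rfl hP μ) _
  have h2 : 0 ≤ cdev (per n P μ) ((u - fun i => (n : ℤ) * z i) μ) := cdev_nonneg (per_pos hn hP μ) _
  rw [Int.cast_abs, Int.cast_abs, abs_of_nonneg (by exact_mod_cast h1), abs_of_nonneg (by exact_mod_cast h2)]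
  -- `(u − nz)_μ = n(b_μ − z_μ) + s` with `0 ≤ s < n`... careful: `s = u_μ − n b_μ ∈ [0, n]`... `hup` gives `≤ n`; use `s < n` from the block
  have hs0 : 0 ≤ u μ - n * b μ := by have := hlow μ; simp only at this; linarith
  have hsn : u μ - n * b μ < n := by
    have hb' : b μ = u μ / (n : ℤ) := by rw [← hb]; rfl
    have hn0 : (0 : ℤ) < n := by exact_mod_cast hn
    have := Int.emod_lt_of_pos (u μ) hn0
    have hdiv := Int.mul_ediv_add_emod (u μ) (n : ℤ)
    rw [hb']; linarith
  have key := cdev_scale hn (hP μ) ((b - z) μ) (u μ - n * b μ) hs0 hsn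
  have e1' : (n : ℤ) * (b - z) μ + (u μ - n * b μ) = (u - fun i => (n : ℤ) * z i) μ := by
    simp only [Pi.sub_apply]; ring
  rw [e1'] at key
  have e2 : per n P μ = n * P μ := rfl
  have e3 : per 1 P μ = P μ := one_mul _
  rw [e2, e3]
  exact_mod_cast key


omit [Fintype ι] [DecidableEq ι] in
/-- **THE DEPTH OF `B^k(y)` IN A PROPER BOX BOUNDS `dist_T(x, □^c)`**: under the `deep` clause (`R` unit blocks between
`B^k(y)` and `∂□`), every fine torus point off `□ + L^ko` is at torus sup-distance `≥ R·L^k` from `x + L^ko`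
(`0 ≤ o`, `o + M ≤ P`: the window `[L^ko_μ, L^k(o_μ+M_μ))` sits inside one period) — the printed restriction
`dist(b, Ω^c) ≥ R₀` for `Ω = □ ⊂ T_η` once `R ≥ R₀`. [cite: Balaban1982Higgs2, Prop. 2.2 (2.58) p. 570; p. 571 «for b ⊂ Ω, dist(b, Ω^c) ≧ R₀», p. 572
«distant from the point y less than … 4r(L^kε)»] -/
theorem deep_tnorm_le {ℓ k : ℕ} {M P : Fin (d + 1) → ℕ} (hP : ∀ ν, 1 ≤ P ν) {o : Fin (d + 1) → ℤ} (ho0 : ∀ i, 0 ≤ o i)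
    (hoP : ∀ i, o i + M i ≤ P i) {Ωc : Finset (Fin (d + 1) → ℤ)} (ho : ∀ y : ↥(boxDom M), y.1 + o ∈ Ωc) {R : ℕ}
    (x : ↥(Box d ℓ k M))
    (hdeep : ∀ i, ((R * (ℓ + 1) ^ k : ℕ) : ℤ) ≤ x.1 i ∧ x.1 i + (R * (ℓ + 1) ^ k : ℕ) + 1 ≤ (((ℓ + 1) ^ k * M i : ℕ) : ℤ))
    {z : Fin (d + 1) → ℤ} (hz1 : z ∈ boxDom (per ((ℓ + 1) ^ k) P)) (hz2 : z ∉ fineDom ((ℓ + 1) ^ k) (boxLabels M o)) :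
    (R : ℝ) * ((((ℓ + 1) ^ k : ℕ) : ℝ)) ≤ tnorm ((ℓ + 1) ^ k) P ((boxEmb ℓ k M o ho x).1 - z) := by
  have hn : 1 ≤ (ℓ + 1) ^ k := Nat.one_le_pow _ _ (Nat.succ_pos ℓ)
  rw [mem_fineDom_boxLabels_iff M o hn] at hz2
  push Not at hz2
  obtain ⟨i, hi⟩ := hz2
  rw [mem_boxDom] at hz1
  obtain ⟨hz0, hzp⟩ := hz1 i
  set v : Fin (d + 1) → ℤ := (boxEmb ℓ k M o ho x).1 - z with hv
  unfold tnorm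
  refine le_trans ?_ (abs_le_supNorm (fun ν => cdev (per ((ℓ + 1) ^ k) P ν) (v ν)) i)
  have hc0 := cdev_nonneg (per_pos hn hP i) (v i)
  rw [Int.cast_abs, abs_of_nonneg (by exact_mod_cast hc0)]
  have hvi : v i = (x.1 i + (((ℓ + 1) ^ k : ℕ) : ℤ) * o i) - z i := rfl
  obtain ⟨hd1, hd2⟩ := hdeep i
  have hz' : z i < (((ℓ + 1) ^ k : ℕ) : ℤ) * o i ∨ (((ℓ + 1) ^ k : ℕ) : ℤ) * (o i + M i) ≤ z i := by
    by_cases hlt : z i < (((ℓ + 1) ^ k : ℕ) : ℤ) * o i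
    · exact Or.inl hlt
    · exact Or.inr (hi (le_of_not_gt hlt))
  have hnn : (0 : ℤ) ≤ (((ℓ + 1) ^ k : ℕ) : ℤ) := by positivity
  have key := cdev_window (p := per ((ℓ + 1) ^ k) P i) (lo := (((ℓ + 1) ^ k : ℕ) : ℤ) * o i)
    (hi := (((ℓ + 1) ^ k : ℕ) : ℤ) * (o i + M i)) (a := x.1 i + (((ℓ + 1) ^ k : ℕ) : ℤ) * o i) (z := z i)
    (m := ((R * (ℓ + 1) ^ k : ℕ) : ℤ))
    (mul_nonneg hnn (ho0 i)) (by simp only [per]; push_cast; nlinarith [hoP i]) (by linarith)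
    (by push_cast at hd2 ⊢; linarith) hz0 hzp hz' (by positivity)
  rw [← hvi] at key
  have key' : ((R * (ℓ + 1) ^ k : ℕ) : ℝ) + 1 ≤ ((cdev (per ((ℓ + 1) ^ k) P i) (v i) : ℤ) : ℝ) := by exact_mod_cast key
  push_cast at key' ⊢
  linarith

omit [Fintype ι] [DecidableEq ι] in
/-- **UNIFORM LATTICE SUMS ON THE TORUS**: `Σ_{y′ ∈ T} e^{−a|b − y′|_{T_1}} ≤ K_{d+1}(a)` for any set `T` of labels in the
period box — each `y′` is replaced by its lift nearest to `b` (an injection), and b05's `latticeSum_le` bounds the lifted sum.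
[cite: Balaban1983RegularityDecay, (2.39) p. 582 with its clause «Σ_{x∈Z^d} e^{−δ₀|x|}» p. 583, p. 572 «periodic conditions»] -/
theorem torus_latticeSum_le {P : Fin (d + 1) → ℕ} (hP : ∀ ν, 1 ≤ P ν) {a : ℝ} (ha : 0 < a)
    (T : Finset (Fin (d + 1) → ℤ)) (hT : T ⊆ boxDom P) (b : Fin (d + 1) → ℤ) :
    ∑ y ∈ T, Real.exp (-(a * tnorm 1 P (b - y))) ≤ B4Sect5Proof.latticeConst (d + 1) a := by
  classical
  -- the nearest lift of each label
  choose t ht using fun y : Fin (d + 1) → ℤ => exists_lift_eq_tnorm (le_refl 1) hP (b - y)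
  set lift : (Fin (d + 1) → ℤ) → (Fin (d + 1) → ℤ) := fun y => y - fun ν => (per 1 P ν : ℤ) * t y ν with hlift
  have hsub : ∀ y, b - lift y = (b - y) + fun ν => (per 1 P ν : ℤ) * t y ν := by
    intro y; simp only [hlift]; abel
  have hinj : Set.InjOn lift ↑T := by
    intro y hy y' hy' h
    have hy1 := mem_boxDom.1 (hT hy)
    have hy2 := mem_boxDom.1 (hT hy')
    funext ν
    have hν := congr_fun h ν
    simp only [hlift, Pi.sub_apply, per, one_mul] at hν
    obtain ⟨a1, a2⟩ := hy1 ν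
    obtain ⟨b1, b2⟩ := hy2 ν
    -- `y ν − P t = y' ν − P t'` with both in `[0, P)` forces `t = t'`
    have hP0 : (0 : ℤ) < P ν := by exact_mod_cast hP ν
    have hdiff : (P ν : ℤ) * (t y ν - t y' ν) = y ν - y' ν := by linarith
    have habs : |y ν - y' ν| < P ν := by rw [abs_lt]; constructor <;> linarith
    have ht0 : t y ν - t y' ν = 0 := by
      by_contra hne
      have h1 : (1 : ℤ) ≤ |t y ν - t y' ν| := Int.one_le_abs hne
      have h2 : (P ν : ℤ) ≤ |y ν - y' ν| := by
        rw [← hdiff, abs_mul, abs_of_pos hP0]; nlinarith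
      linarith
    have htt : t y ν = t y' ν := by linarith
    rw [htt] at hν
    linarith
  have hval : ∀ y, Real.exp (-(a * tnorm 1 P (b - y))) = Real.exp (-(a * supNorm (b - lift y))) := by
    intro y; rw [hsub, ht]
  calc ∑ y ∈ T, Real.exp (-(a * tnorm 1 P (b - y)))
      = ∑ y ∈ T, Real.exp (-(a * supNorm (b - lift y))) := Finset.sum_congr rfl fun y _ => hval y
    _ = ∑ z ∈ T.image lift, Real.exp (-(a * supNorm (b - z))) :=
        (Finset.sum_image (f := fun z => Real.exp (-(a * supNorm (b - z)))) hinj).symm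
    _ ≤ ∑ z ∈ T.image lift, Real.exp (-(a * dist b z)) := by
        refine Finset.sum_le_sum fun z _ => ?_
        rw [Real.exp_le_exp]
        have : dist b z ≤ supNorm (b - z) := by
          rw [dist_pi_le_iff (supNorm_nonneg _)]
          intro i
          rw [Int.dist_eq]
          have h := abs_le_supNorm (b - z) i
          rw [Pi.sub_apply] at h
          push_cast at h
          exact h
        nlinarith
    _ ≤ B4Sect5Proof.latticeConst (d + 1) a := B4Sect5Proof.latticeSum_le (d + 1) ha _ b

end Distances

/-! ## §4 The constants of (2.58) on the torus and the frames linked to them -/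

section Const

variable [Nonempty ι] (F : OrthFlow ι) {ℓ₁ : ℝ} (hℓ₁ : 0 ≤ ℓ₁)
  (hLip : ∀ t (v : ι → ℝ), ((F.U t - 1) *ᵥ v) ⬝ᵥ ((F.U t - 1) *ᵥ v) ≤ (ℓ₁ * t) ^ 2 * (v ⬝ᵥ v))
  (d ℓ : ℕ) (hℓ : 1 ≤ ℓ) (amin aplus m2plus : ℝ) (ha : 0 < amin) (creg β : ℝ) (hcreg : 0 ≤ creg) (hβ : 0 < β)

/-- `δ₀` of (2.58) on r01's torus-pair family (chosen once per frame data). [cite: Balaban1982Higgs2, Prop. 2.2 (2.58) p. 570] -/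
def dT : ℝ := (ineq258_torusPairFam F hℓ₁ hLip d ℓ hℓ amin aplus m2plus ha creg β hcreg hβ).choose

/-- `c₀` of (2.58) on the torus. [cite: Balaban1982Higgs2, Prop. 2.2 (2.58) p. 570] -/
def cT : ℝ := (ineq258_torusPairFam F hℓ₁ hLip d ℓ hℓ amin aplus m2plus ha creg β hcreg hβ).choose_spec.choose

/-- `R₀` of (2.58) on the torus. [cite: Balaban1982Higgs2, Prop. 2.2 (2.58) p. 570; p. 571 «for b ⊂ Ω, dist(b, Ω^c) ≧ R₀»] -/
def rT : ℝ :=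
  (ineq258_torusPairFam F hℓ₁ hLip d ℓ hℓ amin aplus m2plus ha creg β hcreg hβ).choose_spec.choose_spec.choose

/-- `e₁` of (2.58) on the torus («for e(L^kε) sufficiently small»). [cite: Balaban1982Higgs2, Prop. 2.2 p. 570] -/
def eT : ℝ :=
  (ineq258_torusPairFam F hℓ₁ hLip d ℓ hℓ amin aplus m2plus ha creg β hcreg hβ).choose_spec.choose_spec.choose_spec.choose

/-- the defining property of `dT, cT, rT, eT`: (2.58) on the torus, all four clauses, at every regular torus field
(p23 g14's `ineq258_torusPairFam`). [cite: Balaban1982Higgs2, Prop. 2.2 (2.58) pp. 570–571] -/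
theorem T_spec :
    0 < dT F hℓ₁ hLip d ℓ hℓ amin aplus m2plus ha creg β hcreg hβ ∧ 0 < cT F hℓ₁ hLip d ℓ hℓ amin aplus m2plus ha creg β hcreg hβ ∧ 0 < rT F hℓ₁ hLip d ℓ hℓ amin aplus m2plus ha creg β hcreg hβ ∧ 0 < eT F hℓ₁ hLip d ℓ hℓ amin aplus m2plus ha creg β hcreg hβ ∧
    ∀ i : TorusPairInst d ℓ amin aplus m2plus,
      (torusPairFam F d ℓ amin aplus m2plus creg β (KP F hℓ₁ hLip d ℓ hℓ amin aplus m2plus ha) i).regular →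
      (torusPairFam F d ℓ amin aplus m2plus creg β (KP F hℓ₁ hLip d ℓ hℓ amin aplus m2plus ha) i).bigBlocks →
      0 < i.e → i.e ≤ eT F hℓ₁ hLip d ℓ hℓ amin aplus m2plus ha creg β hcreg hβ →
      ∀ (x : ↥(fineDom ((ℓ + 1) ^ i.k) i.ΩT)) (y : ↥i.ΩT) (v : ι → ℝ), rT F hℓ₁ hLip d ℓ hℓ amin aplus m2plus ha creg β hcreg hβ ≤ tcdist i.P x →
        siteNorm (fld (i.GT F *ᵥ tsrc F i y v) x) ≤ cT F hℓ₁ hLip d ℓ hℓ amin aplus m2plus ha creg β hcreg hβ * Real.exp (-(dT F hℓ₁ hLip d ℓ hℓ amin aplus m2plus ha creg β hcreg hβ * tldist i x y)) * siteNorm v ∧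
        (∀ μ : Fin (d + 1), twrap ((ℓ + 1) ^ i.k) i.P (x.1 + e1 μ) ∈ fineDom ((ℓ + 1) ^ i.k) i.ΩT →
          siteNorm (fld (i.DT F μ *ᵥ (i.GT F *ᵥ tsrc F i y v)) x)
            ≤ cT F hℓ₁ hLip d ℓ hℓ amin aplus m2plus ha creg β hcreg hβ * Real.exp (-(dT F hℓ₁ hLip d ℓ hℓ amin aplus m2plus ha creg β hcreg hβ * tldist i x y)) * siteNorm v) ∧
        siteNorm (fld (i.deltaT F (tsrc F i y v)) x)
          ≤ cT F hℓ₁ hLip d ℓ hℓ amin aplus m2plus ha creg β hcreg hβ * Real.exp (-(dT F hℓ₁ hLip d ℓ hℓ amin aplus m2plus ha creg β hcreg hβ * tldist i x y))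
              * Real.exp (-(dT F hℓ₁ hLip d ℓ hℓ amin aplus m2plus ha creg β hcreg hβ * (tcdist i.P x + tcdist i.P (tbase i y)))) * siteNorm v ∧
        (∀ μ : Fin (d + 1), twrap ((ℓ + 1) ^ i.k) i.P (x.1 + e1 μ) ∈ fineDom ((ℓ + 1) ^ i.k) i.ΩT →
          siteNorm (fld (i.DT F μ *ᵥ i.deltaT F (tsrc F i y v)) x)
            ≤ cT F hℓ₁ hLip d ℓ hℓ amin aplus m2plus ha creg β hcreg hβ * Real.exp (-(dT F hℓ₁ hLip d ℓ hℓ amin aplus m2plus ha creg β hcreg hβ * tldist i x y))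
              * Real.exp (-(dT F hℓ₁ hLip d ℓ hℓ amin aplus m2plus ha creg β hcreg hβ * (tcdist i.P x + tcdist i.P (tbase i y)))) * siteNorm v) :=
  (ineq258_torusPairFam F hℓ₁ hLip d ℓ hℓ amin aplus m2plus ha creg β hcreg hβ).choose_spec.choose_spec.choose_spec.choose_spec

omit [Nonempty ι] in
/-- `δ₀` of (2.58) on the whole torus (no `R₀`). [cite: Balaban1982Higgs2, Prop. 2.2 (2.58) p. 570; Balaban1983RegularityDecay, Theorem p. 573 «without any restrictions on the points»] -/
def dR : ℝ := (ineq258_torus_rect F hℓ₁ hLip d ℓ hℓ amin aplus m2plus ha creg β hcreg hβ).choose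

omit [Nonempty ι] in
/-- `c₀` of (2.58) on the whole torus. [cite: Balaban1982Higgs2, Prop. 2.2 (2.58) p. 570] -/
def cR : ℝ := (ineq258_torus_rect F hℓ₁ hLip d ℓ hℓ amin aplus m2plus ha creg β hcreg hβ).choose_spec.choose

omit [Nonempty ι] in
/-- `e₁` of (2.58) on the whole torus. [cite: Balaban1982Higgs2, Prop. 2.2 p. 570] -/
def eR : ℝ := (ineq258_torus_rect F hℓ₁ hLip d ℓ hℓ amin aplus m2plus ha creg β hcreg hβ).choose_spec.choose_spec.choose

omit [Nonempty ι] in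
/-- the defining property of `dR, cR, eR`: the two plain clauses of (2.58) at EVERY point of a member whose `Ω` is the whole
torus (p23 g14's `ineq258_torus_rect`). [cite: Balaban1982Higgs2, Prop. 2.2 (2.58) p. 570; Balaban1983RegularityDecay, Theorem p. 573] -/
theorem R_spec :
    0 < dR F hℓ₁ hLip d ℓ hℓ amin aplus m2plus ha creg β hcreg hβ ∧ 0 < cR F hℓ₁ hLip d ℓ hℓ amin aplus m2plus ha creg β hcreg hβ ∧ 0 < eR F hℓ₁ hLip d ℓ hℓ amin aplus m2plus ha creg β hcreg hβ ∧
    ∀ i : TorusPairInst d ℓ amin aplus m2plus,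
      (torusPairFam F d ℓ amin aplus m2plus creg β (KP F hℓ₁ hLip d ℓ hℓ amin aplus m2plus ha) i).regular →
      (torusPairFam F d ℓ amin aplus m2plus creg β (KP F hℓ₁ hLip d ℓ hℓ amin aplus m2plus ha) i).bigBlocks →
      0 < i.e → i.e ≤ eR F hℓ₁ hLip d ℓ hℓ amin aplus m2plus ha creg β hcreg hβ → fineDom ((ℓ + 1) ^ i.k) i.ΩT = boxDom (per ((ℓ + 1) ^ i.k) i.P) →
      ∀ (x : ↥(fineDom ((ℓ + 1) ^ i.k) i.ΩT)) (y : ↥i.ΩT) (v : ι → ℝ),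
        siteNorm (fld (i.GT F *ᵥ tsrc F i y v) x) ≤ cR F hℓ₁ hLip d ℓ hℓ amin aplus m2plus ha creg β hcreg hβ * Real.exp (-(dR F hℓ₁ hLip d ℓ hℓ amin aplus m2plus ha creg β hcreg hβ * tldist i x y)) * siteNorm v ∧
        (∀ μ : Fin (d + 1), twrap ((ℓ + 1) ^ i.k) i.P (x.1 + e1 μ) ∈ fineDom ((ℓ + 1) ^ i.k) i.ΩT →
          siteNorm (fld (i.DT F μ *ᵥ (i.GT F *ᵥ tsrc F i y v)) x)
            ≤ cR F hℓ₁ hLip d ℓ hℓ amin aplus m2plus ha creg β hcreg hβ * Real.exp (-(dR F hℓ₁ hLip d ℓ hℓ amin aplus m2plus ha creg β hcreg hβ * tldist i x y)) * siteNorm v) :=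
  (ineq258_torus_rect F hℓ₁ hLip d ℓ hℓ amin aplus m2plus ha creg β hcreg hβ).choose_spec.choose_spec.choose_spec

end Const

variable (ι) in
/-- a `FrameS` whose free Proposition-2.2 constants `cO`, `δO`, `SO` dominate the constants of the tree's (2.58) on the
torus, in both regimes (`Ω ≠ T_η`: `dT, cT`; `Ω = T_η`: `dR, cR`): `δO ≤ δ₀`, `a₊·c₀·e^{δ₀} ≤ cO`, and
`K_{d+1}(δO/2) ≤ SO`. [cite: Balaban1982Higgs2, Prop. 2.2 (2.58) p. 570, Lemma 2.4 p. 572] -/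
structure FrameV (d : ℕ) [Nonempty ι] extends FrameS ι d where
  hδT : δO ≤ dT F hℓ₁ hLip d ℓ hℓ amin aplus m2plus ha creg β hcreg hβ
  hcT : aplus * cT F hℓ₁ hLip d ℓ hℓ amin aplus m2plus ha creg β hcreg hβ
    * Real.exp (dT F hℓ₁ hLip d ℓ hℓ amin aplus m2plus ha creg β hcreg hβ) ≤ cO
  hδR : δO ≤ dR F hℓ₁ hLip d ℓ hℓ amin aplus m2plus ha creg β hcreg hβ
  hcR : aplus * cR F hℓ₁ hLip d ℓ hℓ amin aplus m2plus ha creg β hcreg hβ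
    * Real.exp (dR F hℓ₁ hLip d ℓ hℓ amin aplus m2plus ha creg β hcreg hβ) ≤ cO
  hST : B4Sect5Proof.latticeConst (d + 1) (δO / 2) ≤ SO

namespace FrameV

variable [Nonempty ι] {d : ℕ} (fr : FrameV ι d)

/-- `δ₀` of (2.58) on the torus for the frame. [cite: Balaban1982Higgs2, (2.58) p. 570] -/
abbrev dT1 : ℝ := dT fr.F fr.hℓ₁ fr.hLip d fr.ℓ fr.hℓ fr.amin fr.aplus fr.m2plus fr.ha fr.creg fr.β fr.hcreg fr.hβ
/-- `c₀` of (2.58) on the torus for the frame. [cite: Balaban1982Higgs2, (2.58) p. 570] -/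
abbrev cT1 : ℝ := cT fr.F fr.hℓ₁ fr.hLip d fr.ℓ fr.hℓ fr.amin fr.aplus fr.m2plus fr.ha fr.creg fr.β fr.hcreg fr.hβ
/-- `R₀` of (2.58) on the torus for the frame. [cite: Balaban1982Higgs2, (2.58) p. 571] -/
abbrev rT1 : ℝ := rT fr.F fr.hℓ₁ fr.hLip d fr.ℓ fr.hℓ fr.amin fr.aplus fr.m2plus fr.ha fr.creg fr.β fr.hcreg fr.hβ
/-- `e₁` of (2.58) on the torus for the frame. [cite: Balaban1982Higgs2, Prop. 2.2 p. 570] -/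
abbrev eT1 : ℝ := eT fr.F fr.hℓ₁ fr.hLip d fr.ℓ fr.hℓ fr.amin fr.aplus fr.m2plus fr.ha fr.creg fr.β fr.hcreg fr.hβ
/-- `δ₀` of (2.58) on the whole torus for the frame. [cite: Balaban1982Higgs2, (2.58) p. 570] -/
abbrev dR1 : ℝ := dR fr.F fr.hℓ₁ fr.hLip d fr.ℓ fr.hℓ fr.amin fr.aplus fr.m2plus fr.ha fr.creg fr.β fr.hcreg fr.hβ
/-- `c₀` of (2.58) on the whole torus for the frame. [cite: Balaban1982Higgs2, (2.58) p. 570] -/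
abbrev cR1 : ℝ := cR fr.F fr.hℓ₁ fr.hLip d fr.ℓ fr.hℓ fr.amin fr.aplus fr.m2plus fr.ha fr.creg fr.β fr.hcreg fr.hβ
/-- `e₁` of (2.58) on the whole torus for the frame. [cite: Balaban1982Higgs2, Prop. 2.2 p. 570] -/
abbrev eR1 : ℝ := eR fr.F fr.hℓ₁ fr.hLip d fr.ℓ fr.hℓ fr.amin fr.aplus fr.m2plus fr.ha fr.creg fr.β fr.hcreg fr.hβ
/-- the big-block modulus for the frame (r01's `Kmod`). [cite: Balaban1982Higgs2, Prop. 2.2 p. 570 «depending on d, a, M»] -/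
abbrev KV1 : ℕ := KP fr.F fr.hℓ₁ fr.hLip d fr.ℓ fr.hℓ fr.amin fr.aplus fr.m2plus fr.ha

/-- EVERY `FrameS` upgrades to a `FrameV`: shrink `δO` to `min δO (min dT dR)`, enlarge `cO` and `SO` — choices of
constants, no hypothesis on the data. [cite: Balaban1982Higgs2, Lemma 2.4 p. 572] -/
def ofFrameS (fr₀ : FrameS ι d) : FrameV ι d :=
  let δT' : ℝ := dT fr₀.F fr₀.hℓ₁ fr₀.hLip d fr₀.ℓ fr₀.hℓ fr₀.amin fr₀.aplus fr₀.m2plus fr₀.ha fr₀.creg fr₀.β fr₀.hcreg fr₀.hβ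
  let δR' : ℝ := dR fr₀.F fr₀.hℓ₁ fr₀.hLip d fr₀.ℓ fr₀.hℓ fr₀.amin fr₀.aplus fr₀.m2plus fr₀.ha fr₀.creg fr₀.β fr₀.hcreg fr₀.hβ
  let δ' : ℝ := min fr₀.δO (min δT' δR')
  let c' : ℝ := max fr₀.cO (max (fr₀.aplus * cT fr₀.F fr₀.hℓ₁ fr₀.hLip d fr₀.ℓ fr₀.hℓ fr₀.amin fr₀.aplus fr₀.m2plus fr₀.ha fr₀.creg fr₀.β fr₀.hcreg fr₀.hβ * Real.exp δT') (fr₀.aplus * cR fr₀.F fr₀.hℓ₁ fr₀.hLip d fr₀.ℓ fr₀.hℓ fr₀.amin fr₀.aplus fr₀.m2plus fr₀.ha fr₀.creg fr₀.β fr₀.hcreg fr₀.hβ * Real.exp δR'))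
  { toFrameS :=
    { toFrameR :=
      { toFrame := { fr₀.toFrame with
          δO := δ'
          cO := c'
          SO := max fr₀.SO (B4Sect5Proof.latticeConst (d + 1) (δ' / 2))
          cO_nonneg := le_max_of_le_left fr₀.cO_nonneg
          δO_pos := lt_min fr₀.δO_pos (lt_min (T_spec fr₀.F fr₀.hℓ₁ fr₀.hLip d fr₀.ℓ fr₀.hℓ fr₀.amin fr₀.aplus fr₀.m2plus fr₀.ha fr₀.creg fr₀.β fr₀.hcreg fr₀.hβ).1 (R_spec fr₀.F fr₀.hℓ₁ fr₀.hLip d fr₀.ℓ fr₀.hℓ fr₀.amin fr₀.aplus fr₀.m2plus fr₀.ha fr₀.creg fr₀.β fr₀.hcreg fr₀.hβ).1)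
          SO_nonneg := le_max_of_le_left fr₀.SO_nonneg }
        hd := fr₀.hd
        Kθ' := fr₀.Kθ'
        Kθ'_nonneg := fr₀.Kθ'_nonneg
        hKD := fr₀.hKD }
      creg := fr₀.creg
      β := fr₀.β
      hcreg := fr₀.hcreg
      hβ := fr₀.hβ
      S := fr₀.S
      hcI := fr₀.hcI }
    hδT := (min_le_right _ _).trans (min_le_left _ _)
    hcT := (le_max_left _ _).trans (le_max_right _ _)
    hδR := (min_le_right _ _).trans (min_le_right _ _)
    hcR := (le_max_right _ _).trans (le_max_right _ _)
    hST := le_max_right _ _ }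

/-- the upgraded frame keeps the flow. [cite: Balaban1982Higgs2, Lemma 2.4 p. 572] -/
@[simp] theorem ofFrameS_F (fr₀ : FrameS ι d) : (ofFrameS fr₀).F = fr₀.F := rfl

end FrameV


/-! ## §5 The instance on the torus; the four (2.58) kernel fields PROVED; row B2.Lem2.4 for the torus family -/

section Instance

variable [Nonempty ι] {d : ℕ}

/-- **ONE INSTANCE OF LEMMA 2.4 ON THE BOX LINEAGE WITH ITS OUTER REGION ON THE TORUS**: the fields of
`B2Lemma24SupG.ModelT` except `KΩ`, `dΩ`, `dΩ_nonneg`, `summableΩ`, `inc`, `inc_inj`, `φ`, `φΩ_inc` and THE FOUR (2.58)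
KERNEL FIELDS — replaced by the DATA: the torus `T_η = Π_ν ℤ/(L^kP_ν)` (big blocks dividing it),
the corner `o` of the proper box `□₂ = o + [0, M)` (`0 ≤ o`, `o + M ≤ P`, `M_μ < P_μ`), the unit labels `Ω₀T` of
`Ω = B^k(Λ₂′) ⊃ □` (a union of big blocks, possibly the whole torus), the torus component field `A^{(k)}`,
(1.7)/(2.23)-regular on `Ω` (torus differences), its coupling below the (2.58) thresholds, and the depth of `B^k(y)` in
`□` at least `R₀` (and `R₄`); the outer sites at TORUS label distance `≥ R₂` off `□₁`. [cite: Balaban1982Higgs2,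
(2.55)–(2.56) p. 570, Prop. 2.2 (2.58) pp. 570–571, p. 571 sentence after (2.60), Lemma 2.4 and its proof pp. 572–574;
Balaban1983RegularityDecay, p. 572 «operators on subsets of a torus T_η», (1.7) p. 572, §2 p. 575] -/
structure ModelV (fr : FrameV ι d) where
  k : ℕ
  hk : 1 ≤ k
  a : ℝ
  m2 : ℝ
  ha1 : fr.amin ≤ a
  ha2 : a ≤ fr.aplus
  hm1 : 0 ≤ m2
  hm2 : m2 ≤ fr.m2plus
  M : Fin (d + 1) → ℕ
  hM : ∀ i, 1 ≤ M i
  hMS : ∀ i, M i ≤ fr.S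
  hM3 : ∀ i, 3 ≤ (fr.ℓ + 1) ^ k * M i
  /-- the torus `T_η = Π_ν ℤ/(L^kP_ν)`: `P_ν` unit blocks in direction `ν` -/
  P : Fin (d + 1) → ℕ
  /-- the big blocks divide the torus -/
  hKP : ∀ ν, fr.KV1 ∣ P ν
  /-- the lower corner of `□₂` in the unit torus (a representative) -/
  o : Fin (d + 1) → ℤ
  ho0 : ∀ i, 0 ≤ o i
  hoP : ∀ i, o i + M i ≤ P i
  /-- `□₂` is a PROPER box of the torus -/
  hMP : ∀ i, M i < P i
  /-- the unit labels of `Ω = B^k(Λ₂^{(k−1)′})` (representatives in the period box) -/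
  Ω₀T : Finset (Fin (d + 1) → ℤ)
  hΩP : Ω₀T ⊆ boxDom P
  /-- `□₂ ⊂ Λ₂′` -/
  hbox : ∀ y : ↥(boxDom M), y.1 + o ∈ Ω₀T
  /-- `Ω` is a union of big blocks -/
  hbigΩ : IsBlockUnion fr.KV1 Ω₀T
  /-- `□₂` is a union of big blocks -/
  hbigB : IsBlockUnion fr.KV1 (boxLabels M o)
  e : ℝ
  he : 0 < e
  hle : e ≤ fr.eNC1
  /-- `e(L^kε)` below the thresholds of (2.58) on the torus -/
  hleT : e ≤ fr.eT1
  hleR : e ≤ fr.eR1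
  hθ1 : thetaS d fr.S fr.creg fr.β e ≤ 1
  hτ1 : ((d : ℝ) + 1) * thetaS d fr.S fr.creg fr.β e ≤ 1
  /-- the torus component field `A^{(k)}_ν(x)` on the period box of the fine torus -/
  Ac : (Fin (d + 1) → ℤ) → Fin (d + 1) → ℝ
  /-- (2.23)/(1.7) on `Ω = B^k(Λ₂′)`, torus forward differences -/
  hreg : ∀ x ∈ fineDom ((fr.ℓ + 1) ^ k) Ω₀T, ∀ μ ν : Fin (d + 1),
    |Ac (twrap ((fr.ℓ + 1) ^ k) P (x + e1 μ)) ν - Ac x ν| ≤ fr.creg * e ^ (fr.β - 1) / ((fr.ℓ + 1) ^ k : ℕ)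
  x₀ : ↥(Box d fr.ℓ k M)
  y : ↥(boxDom M)
  sq1 : Finset ↥(boxDom M)
  y_mem : y ∈ sq1
  /-- `φ` on the unit sites of `Λ₂′` -/
  φΩ : ↥Ω₀T → ι → ℝ
  p : ℝ
  q : ℝ
  tφ : ℝ
  R₁ : ℝ
  R₂ : ℝ
  R₄ : ℝ
  p_nonneg : 0 ≤ p
  q_nonneg : 0 ≤ q
  tφ_nonneg : 0 ≤ tφ
  R₂_nonneg : 0 ≤ R₂
  q_le : q ≤ fr.K₃ * p
  kap : m2 / (B1.aSeq a ((fr.ℓ : ℝ) + 1) k + m2) * tφ ≤ fr.K₁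
  sepG : Real.exp (-(fr.dG * R₁)) * tφ ≤ fr.K₂
  sepD : Real.exp (-(fr.dD * R₁)) * tφ ≤ fr.K₂
  sepO₂ : Real.exp (-(fr.δO / 2 * R₂)) * tφ ≤ fr.K₄
  sepO₄ : Real.exp (-(fr.δO * R₄)) * tφ ≤ fr.K₅
  θ_scale : thetaS d fr.S fr.creg fr.β e * tφ ≤ fr.Kθ
  τ_scale : ((d : ℝ) + 1) * thetaS d fr.S fr.creg fr.β e * tφ ≤ fr.Kτ
  θ'_scale : fr.creg * e ^ fr.β * tφ ≤ fr.Kθ'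
  far1 : ∀ x : ↥(Box d fr.ℓ k M), blkSite d fr.ℓ k M x = y → ∀ x' : ↥(Box d fr.ℓ k M), blkSite d fr.ℓ k M x' ∉ sq1 →
    R₁ ≤ supNorm (x.1 - x'.1) / (((fr.ℓ + 1) ^ k : ℕ) : ℝ)
  /-- the unit sites of `Λ₆′ ⊂ Λ₂′` carrying `φ` in (2.56) -/
  Tout : Finset ↥Ω₀T
  inc_mem : ∀ y' ∈ sq1, boxEmbY M o hbox y' ∈ Tout
  /-- the sites of (2.56) off `□₁` are at torus label distance `≥ R₂` from `B^k(y)` -/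
  farΩ : ∀ x : ↥(Box d fr.ℓ k M), blkSite d fr.ℓ k M x = y → ∀ y' ∈ Tout, y' ∉ sq1.image (boxEmbY M o hbox) →
    R₂ ≤ tnorm 1 P ((blkSite d fr.ℓ k M x).1 + o - y'.1)
  R : ℕ
  hR1 : 1 ≤ R
  deep : ∀ x : ↥(Box d fr.ℓ k M), blkSite d fr.ℓ k M x = y →
    ∀ i, ((R * (fr.ℓ + 1) ^ k : ℕ) : ℤ) ≤ x.1 i ∧ x.1 i + (R * (fr.ℓ + 1) ^ k : ℕ) + 1 ≤ (((fr.ℓ + 1) ^ k * M i : ℕ) : ℤ)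
  /-- the printed restriction of (2.58): `dist_T(x, □^c) ≥ R₀` on `B^k(y)` -/
  hRT : fr.rT1 ≤ R
  /-- `dist_T(x, □^c) ≥ R₄` on `B^k(y)` -/
  hR4 : R₄ ≤ R

namespace ModelV

variable {fr : FrameV ι d} (m : ModelV fr)

/-- the running coefficient `a_k`. [cite: Balaban1982Higgs2, (2.56) p. 570; Balaban1982Higgs1, (2.15) p. 609] -/
abbrev ak : ℝ := B1.aSeq m.a ((fr.ℓ : ℝ) + 1) m.k

/-- `0 < a_k ≤ a₊`. [cite: Balaban1982Higgs1, (2.15) p. 609] -/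
theorem ak_bounds : 0 < m.ak ∧ m.ak ≤ fr.aplus := by
  have hL : (1 : ℝ) < (fr.ℓ : ℝ) + 1 := by
    have : (1 : ℝ) ≤ (fr.ℓ : ℝ) := by exact_mod_cast fr.hℓ
    linarith
  exact ⟨B1.aSeq_pos (lt_of_lt_of_le fr.ha m.ha1) hL m.hk,
    (B1.aSeq_le (lt_of_lt_of_le fr.ha m.ha1) hL m.k m.hk).trans m.ha2⟩

/-- `P_ν ≥ 1` (from `M_ν < P_ν`). [cite: Balaban1983RegularityDecay, p. 572 «a torus T_η», dictionary] -/
theorem hPT : ∀ ν, 1 ≤ m.P ν := fun ν => Nat.one_le_of_lt (m.hMP ν)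

/-- the fine period is at least `3`: `L^kP_ν ≥ 2·2` (`L ≥ 2`, `k ≥ 1`, `P_ν > M_ν ≥ 1`) — r01's torus-family hypothesis is
automatic for a proper box. [cite: Balaban1983RegularityDecay, p. 572 «a torus T_η … with periodic conditions», dictionary] -/
theorem h3T : ∀ ν, 3 ≤ per ((fr.ℓ + 1) ^ m.k) m.P ν := by
  intro ν
  have hP2 : 2 ≤ m.P ν := Nat.succ_le_of_lt (lt_of_le_of_lt (m.hM ν) (m.hMP ν))
  have hL2 : 2 ≤ (fr.ℓ + 1) ^ m.k :=
    le_trans (by simpa using Nat.succ_le_succ fr.hℓ) (Nat.le_self_pow (Nat.one_le_iff_ne_zero.1 m.hk) (fr.ℓ + 1))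
  show 3 ≤ (fr.ℓ + 1) ^ m.k * m.P ν
  nlinarith

/-- the periodic extension `A^{(k)}_per` of the torus field to `ηℤ^{d+1}`. [cite: Balaban1983RegularityDecay, p. 572 «periodic conditions»] -/
abbrev AcPer : (Fin (d + 1) → ℤ) → Fin (d + 1) → ℝ := perField ((fr.ℓ + 1) ^ m.k) m.P m.Ac

/-- the field seen from the box: `A^{(k)}_per(· + L^ko)` (the `Ac` fed to `ModelT`). [cite: Balaban1982Higgs2, (2.67) p. 572] -/
abbrev AcP : (Fin (d + 1) → ℤ) → Fin (d + 1) → ℝ := shiftF fr.ℓ m.k m.o m.AcPer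

/-- `□₂ + o ⊆ Λ₂′` in labels. [cite: Balaban1982Higgs2, p. 572 «□ ⊂ B^k(Λ₂^{(k−1)′})»] -/
theorem hsubT : boxLabels m.M m.o ⊆ m.Ω₀T := fun y hy => by
  have h := m.hbox ⟨y - m.o, sub_mem_boxDom hy⟩
  simpa using h

/-- the embedding of `□` into the fine torus region `Ω` (`x ↦ x + L^ko`, representatives). [cite: Balaban1982Higgs2, p. 572 «□ ⊂ B^k(Λ₂^{(k−1)′})»] -/
abbrev ET (x : ↥(Box d fr.ℓ m.k m.M)) : ↥(fineDom ((fr.ℓ + 1) ^ m.k) m.Ω₀T) := boxEmb fr.ℓ m.k m.M m.o m.hbox x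

/-- the inclusion of the unit sites of `□₂` into those of `Λ₂′` (the model's `inc`). [cite: Balaban1982Higgs2, p. 572] -/
abbrev incT (y' : ↥(boxDom m.M)) : ↥m.Ω₀T := boxEmbY m.M m.o m.hbox y'

/-- (2.23)/(1.7) on `□` for the field seen from the box (from `hreg` on `Ω ⊃ □`; no torus bond of `□` wraps) — the `hreg`
fed to `ModelT`. [cite: Balaban1982Higgs2, p. 571 «A^{(k)} … satisfies the assumption of Proposition I.2.1»; Balaban1983RegularityDecay, (1.7) p. 572] -/
theorem hreg_box : ∀ x ∈ Box d fr.ℓ m.k m.M, ∀ μ ν : Fin (d + 1),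
    |m.AcP (x + e1 μ) ν - m.AcP x ν| ≤ fr.creg * m.e ^ (fr.β - 1) / ((fr.ℓ + 1) ^ m.k : ℕ) := by
  intro x hx μ ν
  have hmem : (x + fun i => (((fr.ℓ + 1) ^ m.k : ℕ) : ℤ) * m.o i) ∈ fineDom ((fr.ℓ + 1) ^ m.k) m.Ω₀T :=
    (boxEmb fr.ℓ m.k m.M m.o m.hbox ⟨x, hx⟩).2
  have hper : (x + fun i => (((fr.ℓ + 1) ^ m.k : ℕ) : ℤ) * m.o i) ∈ boxDom (per ((fr.ℓ + 1) ^ m.k) m.P) :=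
    val_mem_perBox (hnk fr.ℓ m.k) m.hΩP ⟨_, hmem⟩
  have h := m.hreg _ hmem μ ν
  simp only [AcP, AcPer, shiftF, perField]
  rwa [add_right_comm, twrap_eq_self hper]

/-- THE TORUS PAIR `□ ⊂ Ω` as an instance of r01's torus-pair family (for the `δG_k(□, Ω, A^{(k)})` clauses).
[cite: Balaban1982Higgs2, Prop. 2.2 p. 571 «δG_k(Ω, Ω₀, A)Q_k^*(A)»; Balaban1983RegularityDecay, (1.11) p. 573] -/
abbrev instIT : TorusPairInst d fr.ℓ fr.amin fr.aplus fr.m2plus where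
  k := m.k
  hk := m.hk
  P := m.P
  hP := m.hPT
  h3 := m.h3T
  Ω₀T := m.Ω₀T
  ΩT := boxLabels m.M m.o
  hbox := m.hΩP
  hsub := m.hsubT
  a := m.a
  m2 := m.m2
  ha1 := m.ha1
  ha2 := m.ha2
  hm1 := m.hm1
  hm2 := m.hm2
  Ac := m.Ac
  e := m.e

/-- THE TORUS PAIR `Ω ⊂ Ω` (for the plain clauses of (2.58) on `G_k(Ω, A^{(k)})`). [cite: Balaban1982Higgs2, Prop. 2.2 (2.58) p. 570] -/
abbrev instOT : TorusPairInst d fr.ℓ fr.amin fr.aplus fr.m2plus where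
  k := m.k
  hk := m.hk
  P := m.P
  hP := m.hPT
  h3 := m.h3T
  Ω₀T := m.Ω₀T
  ΩT := m.Ω₀T
  hbox := m.hΩP
  hsub := Finset.Subset.refl _
  a := m.a
  m2 := m.m2
  ha1 := m.ha1
  ha2 := m.ha2
  hm1 := m.hm1
  hm2 := m.hm2
  Ac := m.Ac
  e := m.e

/-- `regular` of the torus pair `□ ⊂ Ω` ((1.7) on `Ω`). [cite: Balaban1983RegularityDecay, (1.7) p. 572] -/
theorem instIT_regular : (torusPairFam fr.F d fr.ℓ fr.amin fr.aplus fr.m2plus fr.creg fr.β fr.KV1 m.instIT).regular :=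
  m.hreg

/-- `regular` of the torus pair `Ω ⊂ Ω`. [cite: Balaban1983RegularityDecay, (1.7) p. 572] -/
theorem instOT_regular : (torusPairFam fr.F d fr.ℓ fr.amin fr.aplus fr.m2plus fr.creg fr.β fr.KV1 m.instOT).regular :=
  m.hreg

/-- `bigBlocks` of the torus pair `□ ⊂ Ω`. [cite: Balaban1983RegularityDecay, p. 575 «Ω is a sum of … large blocks … on η-lattice T_η»] -/
theorem instIT_bigBlocks :
    (torusPairFam fr.F d fr.ℓ fr.amin fr.aplus fr.m2plus fr.creg fr.β fr.KV1 m.instIT).bigBlocks :=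
  ⟨m.hbigΩ, m.hbigB, m.hKP⟩

/-- `bigBlocks` of the torus pair `Ω ⊂ Ω`. [cite: Balaban1983RegularityDecay, p. 575] -/
theorem instOT_bigBlocks :
    (torusPairFam fr.F d fr.ℓ fr.amin fr.aplus fr.m2plus fr.creg fr.β fr.KV1 m.instOT).bigBlocks :=
  ⟨m.hbigΩ, m.hbigΩ, m.hKP⟩

/-- **THE OUTER KERNEL `K_Ω(x, y′) = a_k(G_k(Ω, A^{(k)})Q_k^*(A^{(k)}))(x, y′)` of (2.56) ON THE TORUS**, `x ∈ □`, `y′ ∈ Λ₂′`: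
the `(x + L^ko, y′)` block of r01's TORUS Green's function `G_k(Ω,A)` composed with the carrier's `Q_k(A)ᵀ` — the `KΩ` fed
to `ModelT`. [cite: Balaban1982Higgs2, (2.56) p. 570, (2.58) p. 570; Balaban1983RegularityDecay, (1.6) p. 572 «operators on subsets of a torus T_η»] -/
def KΩT (x : ↥(Box d fr.ℓ m.k m.M)) (y' : ↥m.Ω₀T) : Matrix ι ι ℝ :=
  Matrix.of fun i j => (m.ak • (m.instOT.GT fr.F
    * (avgQ fr.F m.instOT.κ (one_le_nT m.instOT) m.Ω₀T (tbond m.instOT m.Ω₀T))ᵀ)) (m.ET x, i) (y', j)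

/-- the TORUS label distance `|y(x) + o − y′|_{T_1}` between the block of `x` and the site `y′` — the `dΩ` fed to `ModelT`.
[cite: Balaban1982Higgs2, (2.58) p. 570 «dist(b, y)»; Balaban1983RegularityDecay, p. 572 «periodic conditions», dictionary] -/
def dLT (x : ↥(Box d fr.ℓ m.k m.M)) (y' : ↥m.Ω₀T) : ℝ := tnorm 1 m.P ((blkSite d fr.ℓ m.k m.M x).1 + m.o - y'.1)

/-- `dΩ ≥ 0` — the field `dΩ_nonneg`. [cite: Balaban1982Higgs2, (2.58) p. 570, dictionary] -/
theorem dLT_nonneg (x : ↥(Box d fr.ℓ m.k m.M)) (y' : ↥m.Ω₀T) : 0 ≤ m.dLT x y' := tnorm_nonneg _ _ _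

/-- **`K_Ω` IS r01's TORUS `G_k(Ω, A)` OF THE PAIR `□ ⊂ Ω` composed with `Q_k(A)ᵀ`, times `a_k`** (record form:
`TorusPairInst.G₀T` of `instIT`; definitional). [cite: Balaban1982Higgs2, (2.56) p. 570; Balaban1983RegularityDecay, (1.6) p. 572] -/
theorem KΩT_eq (x : ↥(Box d fr.ℓ m.k m.M)) (y' : ↥m.Ω₀T) :
    m.KΩT x y' = Matrix.of fun i j => (m.ak • (m.instIT.G₀T fr.F
      * (avgQ fr.F m.instIT.κ (one_le_nT m.instIT) m.Ω₀T (tbond m.instIT m.Ω₀T))ᵀ)) (m.ET x, i) (y', j) := rfl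

/-- `K_Ω(x,y′)v = a_k·(G_k(Ω,A)f_{y′,v})(x + L^ko)` with the torus source `f_{y′,v} = Q_k^*(A)(vδ_{y′})`.
[cite: Balaban1982Higgs2, (2.56) p. 570, (2.58) p. 570] -/
theorem KΩT_mulVec (x : ↥(Box d fr.ℓ m.k m.M)) (y' : ↥m.Ω₀T) (v : ι → ℝ) :
    m.KΩT x y' *ᵥ v = m.ak • fld (m.instOT.GT fr.F *ᵥ tsrc fr.F m.instOT y' v) (m.ET x) := by
  rw [KΩT, tsrc, ← fld_mul_avgQ_transpose_mulVec_single, ← block_mulVec_eq_fld, ← Matrix.smul_mulVec]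
  rfl

/-- **`G_k(□, A)` ON THE TORUS IS THE BOX LINEAGE'S REGION GREEN'S FUNCTION at the periodic field** (`torusOp_eq_regionOp`).
[cite: Balaban1983RegularityDecay, (1.6) p. 572] -/
theorem GT_I_eq : m.instIT.GT fr.F
    = (regionOp fr.F m.e (hnk fr.ℓ m.k) m.ak m.m2 (boxLabels m.M m.o) m.AcPer)⁻¹ := by
  show (torusOp fr.F m.e _ m.ak m.m2 m.P (boxLabels m.M m.o) m.Ac)⁻¹ = _
  rw [torusOp_eq_regionOp (hnk fr.ℓ m.k) m.h3T m.ho0 m.hoP m.hMP]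

/-- the torus source on `□` is the region source at the periodic field. [cite: Balaban1982Higgs2, p. 570 «Q_k^*(A)»; Balaban1983RegularityDecay, (1.4) p. 572] -/
theorem tsrc_I_eq (y' : ↥(boxLabels m.M m.o)) (v : ι → ℝ) :
    tsrc fr.F m.instIT y' v = srcQ fr.F (κS fr.ℓ m.k m.e) (hnk fr.ℓ m.k) (boxLabels m.M m.o)
      (acBond (boxLabels m.M m.o) m.AcPer) y' v := by
  show (avgQ fr.F (κS fr.ℓ m.k m.e) (hnk fr.ℓ m.k) (boxLabels m.M m.o)
      (fun u w : ↥(fineDom ((fr.ℓ + 1) ^ m.k) (boxLabels m.M m.o)) => torBond ((fr.ℓ + 1) ^ m.k) m.P m.Ac u.1 w.1))ᵀ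
        *ᵥ single y' v = _
  rw [avgQ_tor_eq (hnk fr.ℓ m.k) m.h3T fr.F _ (boxLabels_subset_boxDom m.ho0 m.hoP) m.Ac]
  rfl

/-- **`D^η_{A,μ}` OF THE TORUS REGION `□` ON A BOND OF THE BOX IS THE LATTICE DERIVATIVE at the periodic field**.
[cite: Balaban1983RegularityDecay, (1.3) p. 572] -/
theorem fld_DT_I_eq (μ : Fin (d + 1)) (x : ↥(Box d fr.ℓ m.k m.M)) (h : x.1 + e1 μ ∈ Box d fr.ℓ m.k m.M)
    (Φ : ↥(fineDom ((fr.ℓ + 1) ^ m.k) (boxLabels m.M m.o)) × ι → ℝ) :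
    fld (m.instIT.DT fr.F μ *ᵥ Φ) (eB fr.ℓ m.k m.M m.o x)
      = fld (regionDeriv fr.F m.e ((fr.ℓ + 1) ^ m.k) (boxLabels m.M m.o) m.AcPer μ *ᵥ Φ) (eB fr.ℓ m.k m.M m.o x) := by
  show fld (torusDeriv fr.F m.e ((fr.ℓ + 1) ^ m.k) m.P (boxLabels m.M m.o) m.Ac μ *ᵥ Φ) _ = _
  rw [fld_torusDeriv_boxEmb fr.F m.e fr.ℓ m.k m.M m.o m.h3T (boxLabels_subset_boxDom m.ho0 m.hoP) m.Ac _ μ Φ x h,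
    fld_regionDeriv_boxEmb fr.F m.e fr.ℓ m.k m.M m.o m.AcPer _ μ Φ x h]

/-- the `(x, y′+o)` block against the box kernel: `K_Ω(x, y′+o)v − K_□(x, y′)v = −a_k·(δG_k(□,Ω,A)f_{y′+o,v})(x + L^ko)`
(`δG_k(□,Ω,A) = G_k(□,A) − G_k(Ω,A)` on the torus, r01's `deltaT`; `extT_tsrc`). [cite: Balaban1982Higgs2, Prop. 2.2 p. 571
«δG_k(Ω,Ω₀,A)Q_k^*(A)»; Balaban1983RegularityDecay, (1.11) p. 573] -/
theorem KΩT_sub_kerBox_mulVec (x : ↥(Box d fr.ℓ m.k m.M)) (y' : ↥(boxDom m.M)) (v : ι → ℝ) :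
    (m.KΩT x (m.incT y') - kerBox d fr.F (κS fr.ℓ m.k m.e) fr.ℓ m.k m.a m.m2 m.M (embS d fr.ℓ m.k m.M) (ΓS d fr.ℓ m.k m.M)
        (A0S d m.AcP m.x₀) (AprS d fr.ℓ m.k m.M (A0S d m.AcP m.x₀) m.AcP) x y') *ᵥ v
      = -(m.ak • fld (m.instIT.deltaT fr.F (tsrc fr.F m.instIT (eY m.M m.o y') v)) (eB fr.ℓ m.k m.M m.o x)) := by
  rw [Matrix.sub_mulVec, KΩT_mulVec,
    kerBox_mulVec_eq fr.F m.e fr.ℓ m.k m.a m.m2 m.M m.o m.AcPer _ (constBond_add_AprS fr.ℓ m.k m.M _ _)]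
  rw [← smul_sub, ← smul_neg]
  congr 1
  funext j
  rw [Pi.neg_apply, TorusPairInst.fld_deltaT, extT_tsrc, GT_I_eq, tsrc_I_eq]
  simp only [Pi.sub_apply, neg_sub]
  rfl

/-- the derivative kernel of `K_Ω` along a bond `(x, x+e_μ) ⊂ □`: `(D^η_{A,μ}K_Ω)(b, y′)v = a_k·(D^η_{A,μ}G_k(Ω,A)f_{y′,v})(x + L^ko)`
(the torus derivative along an embedded bond: `fld_torusDeriv_boxEmb`). [cite: Balaban1982Higgs2, (2.58) p. 570, (2.66) p. 572;
Balaban1983RegularityDecay, (1.3) p. 572] -/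
theorem dKer_KΩT_mulVec (μ : Fin (d + 1)) (x : ↥(Box d fr.ℓ m.k m.M)) (h : x.1 + e1 μ ∈ Box d fr.ℓ m.k m.M) (y' : ↥m.Ω₀T)
    (v : ι → ℝ) :
    dKer d fr.F (κS fr.ℓ m.k m.e) fr.ℓ m.k m.M (fun u w => compField m.AcP u.1 w.1) m.KΩT μ x h y' *ᵥ v
      = m.ak • fld (m.instOT.DT fr.F μ *ᵥ (m.instOT.GT fr.F *ᵥ tsrc fr.F m.instOT y' v)) (m.ET x) := by
  rw [dKer, Matrix.smul_mulVec, Matrix.sub_mulVec, ← Matrix.mulVec_mulVec, KΩT_mulVec, KΩT_mulVec, Matrix.mulVec_smul,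
    ← smul_sub, smul_comm]
  congr 1
  exact (fld_torusDeriv_boxEmb fr.F m.e fr.ℓ m.k m.M m.o m.h3T m.hΩP m.Ac m.hbox μ _ x h).symm

/-- the derivative blocks against the box: `(D_μK_Ω)(b, y′+o)v − (D_μK_□)(b, y′)v = −a_k·(D^η_{A,μ}δG_k(□,Ω,A)f_{y′+o,v})(x + L^ko)`
(r01's `fld_DT_deltaT` on the torus bond of `□`). [cite: Balaban1982Higgs2, Prop. 2.2 p. 571 «D^η_AδG_k(Ω,Ω₀,A)Q_k^*(A)»;
Balaban1983RegularityDecay, (1.11) p. 573] -/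
theorem dKer_sub_dkerBox_mulVec (μ : Fin (d + 1)) (x : ↥(Box d fr.ℓ m.k m.M)) (h : x.1 + e1 μ ∈ Box d fr.ℓ m.k m.M)
    (y' : ↥(boxDom m.M)) (v : ι → ℝ) :
    (dKer d fr.F (κS fr.ℓ m.k m.e) fr.ℓ m.k m.M
        (constBond (A0S d m.AcP m.x₀) Subtype.val + AprS d fr.ℓ m.k m.M (A0S d m.AcP m.x₀) m.AcP) m.KΩT μ x h (m.incT y')
      - dkerBox d fr.F (κS fr.ℓ m.k m.e) fr.ℓ m.k m.a m.m2 m.M (embS d fr.ℓ m.k m.M) (ΓS d fr.ℓ m.k m.M)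
          (A0S d m.AcP m.x₀) (AprS d fr.ℓ m.k m.M (A0S d m.AcP m.x₀) m.AcP) μ x y') *ᵥ v
      = -(m.ak • fld (m.instIT.DT fr.F μ *ᵥ m.instIT.deltaT fr.F
          (tsrc fr.F m.instIT (eY m.M m.o y') v)) (eB fr.ℓ m.k m.M m.o x)) := by
  rw [Matrix.sub_mulVec, constBond_add_AprS, dKer_KΩT_mulVec,
    dkerBox_mulVec_eq fr.F m.e fr.ℓ m.k m.a m.m2 m.M m.o m.AcPer _ (constBond_add_AprS fr.ℓ m.k m.M _ _)]
  rw [← smul_sub, ← smul_neg]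
  congr 1
  funext j
  have hx : twrap ((fr.ℓ + 1) ^ m.instIT.k) m.instIT.P ((eB fr.ℓ m.k m.M m.o x).1 + e1 μ)
      ∈ fineDom ((fr.ℓ + 1) ^ m.instIT.k) m.instIT.ΩT :=
    twrap_boxEmb_add_e1_mem fr.ℓ m.k m.M m.o (boxLabels_subset_boxDom m.ho0 m.hoP) (shift_mem_boxLabels m.M m.o) μ x h
  rw [Pi.neg_apply, TorusPairInst.fld_DT_deltaT _ _ μ _ _ hx, extT_tsrc, fld_DT_I_eq _ μ x h, GT_I_eq, tsrc_I_eq]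
  simp only [Pi.sub_apply, neg_sub]
  rfl

/-! ### The printed restriction `dist_T(x, □^c) ≥ R₀` and the distance bookkeeping -/

/-- `dist_T(x, □^c) ≥ R` on `B^k(y)` (the depth of the block in `□`). [cite: Balaban1982Higgs2, Prop. 2.2 (2.58) p. 570; p. 571 «for b ⊂ Ω, dist(b, Ω^c) ≧ R₀»] -/
theorem R_le_tcdistI (x : ↥(Box d fr.ℓ m.k m.M)) (hx : blkSite d fr.ℓ m.k m.M x = m.y) :
    (m.R : ℝ) ≤ tcdist m.P (eB fr.ℓ m.k m.M m.o x) :=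
  le_tcdist (hnk fr.ℓ m.k) _ (exists_torus_pt_off_box (hnk fr.ℓ m.k) m.ho0 m.hMP)
    fun _ hz1 hz2 => deep_tnorm_le m.hPT m.ho0 m.hoP _ x (m.deep x hx) hz1 hz2

/-- `dist_T(x, Ω^c) ≥ R` on `B^k(y)` when `Ω ⊃ □` is not the whole torus. [cite: Balaban1982Higgs2, Prop. 2.2 (2.58) p. 570; p. 571 «for b ⊂ Ω, dist(b, Ω^c) ≧ R₀»] -/
theorem R_le_tcdistO (x : ↥(Box d fr.ℓ m.k m.M)) (hx : blkSite d fr.ℓ m.k m.M x = m.y)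
    (hne : (boxDom (per ((fr.ℓ + 1) ^ m.k) m.P) \ fineDom ((fr.ℓ + 1) ^ m.k) m.Ω₀T).Nonempty) :
    (m.R : ℝ) ≤ tcdist m.P (m.ET x) :=
  le_tcdist (hnk fr.ℓ m.k) _ hne fun _ hz1 hz2 => deep_tnorm_le m.hPT m.ho0 m.hoP m.hbox x (m.deep x hx) hz1
    fun hz' => hz2 (B4RegionCubeCarrier.fineDom_mono (hnk fr.ℓ m.k) m.hsubT hz')

/-- **THE DECAY FACTOR OF (2.58) AGAINST THE TORUS LABEL DISTANCE** on `Ω`: `e^{−δdist_T(x,y′)} ≤ e^{δ}e^{−δO|y(x)+o−y′|_{T_1}}`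
for `δO ≤ δ`. [cite: Balaban1982Higgs2, (2.58) p. 570 «exp(−δ₀ dist(b, y))», dictionary] -/
theorem exp_tldistO_le {δ : ℝ} (hδ0 : 0 ≤ δ) (hδ : fr.δO ≤ δ) (x : ↥(Box d fr.ℓ m.k m.M)) (y' : ↥m.Ω₀T) :
    Real.exp (-(δ * tldist m.instOT (m.ET x) y')) ≤ Real.exp δ * Real.exp (-(fr.δO * m.dLT x y')) := by
  have hn0 : (0 : ℝ) < (((fr.ℓ + 1) ^ m.k : ℕ) : ℝ) := by exact_mod_cast (hnk fr.ℓ m.k)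
  have h1 : m.dLT x y' - 1 ≤ tldist m.instOT (m.ET x) y' := by
    unfold dLT tldist
    rw [le_div_iff₀ hn0, mul_comm]
    exact tnorm_label_le (hnk fr.ℓ m.k) m.hPT (blk_boxEmb fr.ℓ m.k m.M m.o m.hbox x) y'.1
  rw [← Real.exp_add, Real.exp_le_exp]
  have h2 := mul_le_mul_of_nonneg_left h1 hδ0
  have h3 := mul_le_mul_of_nonneg_right hδ (m.dLT_nonneg x y')
  nlinarith

/-- the same on `□` for a label of `□₂`. [cite: Balaban1982Higgs2, (2.58) p. 570, dictionary] -/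
theorem exp_tldistI_le {δ : ℝ} (hδ0 : 0 ≤ δ) (hδ : fr.δO ≤ δ) (x : ↥(Box d fr.ℓ m.k m.M)) (y' : ↥(boxDom m.M)) :
    Real.exp (-(δ * tldist m.instIT (eB fr.ℓ m.k m.M m.o x) (eY m.M m.o y')))
      ≤ Real.exp δ * Real.exp (-(fr.δO * m.dLT x (m.incT y'))) := by
  have hn0 : (0 : ℝ) < (((fr.ℓ + 1) ^ m.k : ℕ) : ℝ) := by exact_mod_cast (hnk fr.ℓ m.k)
  have h1 : m.dLT x (m.incT y') - 1 ≤ tldist m.instIT (eB fr.ℓ m.k m.M m.o x) (eY m.M m.o y') := by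
    unfold dLT tldist
    rw [le_div_iff₀ hn0, mul_comm]
    exact tnorm_label_le (hnk fr.ℓ m.k) m.hPT (blk_boxEmb fr.ℓ m.k m.M m.o (shift_mem_boxLabels m.M m.o) x) (y'.1 + m.o)
  rw [← Real.exp_add, Real.exp_le_exp]
  have h2 := mul_le_mul_of_nonneg_left h1 hδ0
  have h3 := mul_le_mul_of_nonneg_right hδ (m.dLT_nonneg x (m.incT y'))
  nlinarith

/-- the `δG` factor: `e^{−δ₀(dist_T(x,□^c) + dist_T(y′,□^c))} ≤ e^{−δO R₄}` on `B^k(y)` (`dist_T(x, □^c) ≥ R ≥ R₄`, `δO ≤ δ₀`).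
[cite: Balaban1982Higgs2, Prop. 2.2 p. 571 «with the additional factor exp(−δ₀(dist(b,Ω^c) + dist(y,Ω^c)))»] -/
theorem exp_tcdist_le (x : ↥(Box d fr.ℓ m.k m.M)) (hx : blkSite d fr.ℓ m.k m.M x = m.y) (y' : ↥(boxDom m.M)) :
    Real.exp (-(fr.dT1 * (tcdist m.P (eB fr.ℓ m.k m.M m.o x) + tcdist m.P (tbase m.instIT (eY m.M m.o y')))))
      ≤ Real.exp (-(fr.δO * m.R₄)) := by
  have hdT := (T_spec fr.F fr.hℓ₁ fr.hLip d fr.ℓ fr.hℓ fr.amin fr.aplus fr.m2plus fr.ha fr.creg fr.β fr.hcreg fr.hβ).1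
  rw [Real.exp_le_exp]
  have h1 := m.R_le_tcdistI x hx
  have h2 := tcdist_nonneg m.P (tbase m.instIT (eY m.M m.o y'))
  have h3 : fr.δO * m.R₄ ≤ fr.δO * m.R := mul_le_mul_of_nonneg_left m.hR4 fr.δO_pos.le
  have h4 : fr.δO * (m.R : ℝ) ≤ fr.dT1 * m.R := mul_le_mul_of_nonneg_right fr.hδT (Nat.cast_nonneg _)
  have h5 := mul_le_mul_of_nonneg_left h1 hdT.le
  nlinarith

/-! ### The four (2.58) kernel fields as theorems -/

/-- **(2.58) FOR `G_k(Ω,A^{(k)})Q_k^*(A^{(k)})` ON THE TORUS — THE FIELD `kerΩ_far` PROVED**: for `x ∈ B^k(y)` and every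
`y′ ∈ Λ₂′`, `|K_Ω(x,y′)v| ≤ cO·e^{−δO|y(x)+o−y′|_{T_1}}|v|` — from `ineq258_torusPairFam` when `Ω ≠ T_η` (the depth of `B^k(y)`
in `□` gives `dist_T(x, Ω^c) ≥ R₀`) and from `ineq258_torus_rect` when `Ω = T_η`. [cite: Balaban1982Higgs2, Prop. 2.2 (2.58)
p. 570 «The identical inequality holds for G_k(Ω, A)Q_k^*(A)», (2.67) p. 572; Balaban1983RegularityDecay, Theorem p. 573] -/
theorem kerΩ_far (x : ↥(Box d fr.ℓ m.k m.M)) (hx : blkSite d fr.ℓ m.k m.M x = m.y) (y' : ↥m.Ω₀T) (v : ι → ℝ) :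
    siteNorm (m.KΩT x y' *ᵥ v) ≤ fr.cO * Real.exp (-(fr.δO * m.dLT x y')) * siteNorm v := by
  obtain ⟨hak0, hak1⟩ := m.ak_bounds
  have hv := siteNorm_nonneg v
  rw [KΩT_mulVec, siteNorm_smul, abs_of_pos hak0]
  by_cases hrect : fineDom ((fr.ℓ + 1) ^ m.k) m.Ω₀T = boxDom (per ((fr.ℓ + 1) ^ m.k) m.P)
  · obtain ⟨hdR, hcR, -, H⟩ := R_spec fr.F fr.hℓ₁ fr.hLip d fr.ℓ fr.hℓ fr.amin fr.aplus fr.m2plus fr.ha fr.creg fr.β fr.hcreg fr.hβ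
    have h1 := (H m.instOT m.instOT_regular m.instOT_bigBlocks m.he m.hleR hrect (m.ET x) y' v).1
    have he := m.exp_tldistO_le hdR.le fr.hδR x y'
    calc m.ak * siteNorm (fld (m.instOT.GT fr.F *ᵥ tsrc fr.F m.instOT y' v) (m.ET x))
        ≤ fr.aplus * (fr.cR1 * (Real.exp fr.dR1 * Real.exp (-(fr.δO * m.dLT x y'))) * siteNorm v) := by
          refine mul_le_mul hak1 (h1.trans ?_) (siteNorm_nonneg _) fr.aplus_pos.le
          exact mul_le_mul_of_nonneg_right (mul_le_mul_of_nonneg_left he hcR.le) hv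
      _ = (fr.aplus * fr.cR1 * Real.exp fr.dR1) * (Real.exp (-(fr.δO * m.dLT x y')) * siteNorm v) := by ring
      _ ≤ fr.cO * (Real.exp (-(fr.δO * m.dLT x y')) * siteNorm v) := mul_le_mul_of_nonneg_right fr.hcR (by positivity)
      _ = fr.cO * Real.exp (-(fr.δO * m.dLT x y')) * siteNorm v := by ring
  · have hne : (boxDom (per ((fr.ℓ + 1) ^ m.k) m.P) \ fineDom ((fr.ℓ + 1) ^ m.k) m.Ω₀T).Nonempty := by
      rw [Finset.sdiff_nonempty]
      intro hsub'
      exact hrect (Finset.Subset.antisymm (fun z hz => val_mem_perBox (hnk fr.ℓ m.k) m.hΩP ⟨z, hz⟩) hsub')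
    obtain ⟨hdT, hcT, -, -, H⟩ := T_spec fr.F fr.hℓ₁ fr.hLip d fr.ℓ fr.hℓ fr.amin fr.aplus fr.m2plus fr.ha fr.creg fr.β fr.hcreg fr.hβ
    have h1 := (H m.instOT m.instOT_regular m.instOT_bigBlocks m.he m.hleT (m.ET x) y' v
      (m.hRT.trans (m.R_le_tcdistO x hx hne))).1
    have he := m.exp_tldistO_le hdT.le fr.hδT x y'
    calc m.ak * siteNorm (fld (m.instOT.GT fr.F *ᵥ tsrc fr.F m.instOT y' v) (m.ET x))
        ≤ fr.aplus * (fr.cT1 * (Real.exp fr.dT1 * Real.exp (-(fr.δO * m.dLT x y'))) * siteNorm v) := by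
          refine mul_le_mul hak1 (h1.trans ?_) (siteNorm_nonneg _) fr.aplus_pos.le
          exact mul_le_mul_of_nonneg_right (mul_le_mul_of_nonneg_left he hcT.le) hv
      _ = (fr.aplus * fr.cT1 * Real.exp fr.dT1) * (Real.exp (-(fr.δO * m.dLT x y')) * siteNorm v) := by ring
      _ ≤ fr.cO * (Real.exp (-(fr.δO * m.dLT x y')) * siteNorm v) := mul_le_mul_of_nonneg_right fr.hcT (by positivity)
      _ = fr.cO * Real.exp (-(fr.δO * m.dLT x y')) * siteNorm v := by ring

/-- **(2.58) FOR `δG_k(□,Ω,A^{(k)})Q_k^*(A^{(k)})` ON THE TORUS — THE FIELD `kerΩ_near` PROVED**: for `x ∈ B^k(y)` and `y′ ∈ □₂`,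
`|(K_Ω(x,y′+o) − K_□(x,y′))v| ≤ cO·e^{−δO R₄}·e^{−δO|y(x)−y′|_{T_1}}|v|`. [cite: Balaban1982Higgs2, Prop. 2.2 p. 571 «and for …
δG_k(Ω, Ω₀, A)Q_k^*(A) with the additional factor», (2.67) p. 572] -/
theorem kerΩ_near (x : ↥(Box d fr.ℓ m.k m.M)) (hx : blkSite d fr.ℓ m.k m.M x = m.y) (y' : ↥(boxDom m.M)) (v : ι → ℝ) :
    siteNorm ((m.KΩT x (m.incT y') - kerBox d fr.F (κS fr.ℓ m.k m.e) fr.ℓ m.k m.a m.m2 m.M (embS d fr.ℓ m.k m.M)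
        (ΓS d fr.ℓ m.k m.M) (A0S d m.AcP m.x₀) (AprS d fr.ℓ m.k m.M (A0S d m.AcP m.x₀) m.AcP) x y') *ᵥ v)
      ≤ fr.cO * Real.exp (-(fr.δO * m.R₄)) * Real.exp (-(fr.δO * m.dLT x (m.incT y'))) * siteNorm v := by
  obtain ⟨hak0, hak1⟩ := m.ak_bounds
  obtain ⟨hdT, hcT, -, -, H⟩ := T_spec fr.F fr.hℓ₁ fr.hLip d fr.ℓ fr.hℓ fr.amin fr.aplus fr.m2plus fr.ha fr.creg fr.β fr.hcreg fr.hβ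
  have h3 := (H m.instIT m.instIT_regular m.instIT_bigBlocks m.he m.hleT (eB fr.ℓ m.k m.M m.o x) (eY m.M m.o y') v
    (m.hRT.trans (m.R_le_tcdistI x hx))).2.2.1
  have hv := siteNorm_nonneg v
  have he := m.exp_tldistI_le hdT.le fr.hδT x y'
  have hc := m.exp_tcdist_le x hx y'
  rw [KΩT_sub_kerBox_mulVec, B4Lemma22PertVSup.siteNorm_neg, siteNorm_smul, abs_of_pos hak0]
  calc m.ak * siteNorm (fld (m.instIT.deltaT fr.F (tsrc fr.F m.instIT (eY m.M m.o y') v)) (eB fr.ℓ m.k m.M m.o x))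
      ≤ fr.aplus * (fr.cT1 * (Real.exp fr.dT1 * Real.exp (-(fr.δO * m.dLT x (m.incT y'))))
          * Real.exp (-(fr.δO * m.R₄)) * siteNorm v) := by
        refine mul_le_mul hak1 (h3.trans ?_) (siteNorm_nonneg _) fr.aplus_pos.le
        refine mul_le_mul (mul_le_mul (mul_le_mul_of_nonneg_left he hcT.le) hc (Real.exp_pos _).le
          (by positivity)) le_rfl hv (by positivity)
    _ = (fr.aplus * fr.cT1 * Real.exp fr.dT1)
          * (Real.exp (-(fr.δO * m.R₄)) * Real.exp (-(fr.δO * m.dLT x (m.incT y'))) * siteNorm v) := by ring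
    _ ≤ fr.cO * (Real.exp (-(fr.δO * m.R₄)) * Real.exp (-(fr.δO * m.dLT x (m.incT y'))) * siteNorm v) :=
        mul_le_mul_of_nonneg_right fr.hcT (by positivity)
    _ = fr.cO * Real.exp (-(fr.δO * m.R₄)) * Real.exp (-(fr.δO * m.dLT x (m.incT y'))) * siteNorm v := by ring

/-- **(2.58) FOR `D^η_AG_k(Ω,A^{(k)})Q_k^*(A^{(k)})` ON THE TORUS — THE FIELD `dkerΩ_far` PROVED**: on every bond
`(x, x+e_μ) ⊂ □` with `x ∈ B^k(y)`, `|(D^η_{A,μ}K_Ω)(b,y′)v| ≤ cO·e^{−δO|y(x)+o−y′|_{T_1}}|v|` (both regimes of `Ω`).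
[cite: Balaban1982Higgs2, Prop. 2.2 (2.58) p. 570, (2.67) p. 572 «the same equality for the covariant derivative»;
Balaban1983RegularityDecay, Theorem p. 573] -/
theorem dkerΩ_far (μ : Fin (d + 1)) (x : ↥(Box d fr.ℓ m.k m.M)) (hx : blkSite d fr.ℓ m.k m.M x = m.y)
    (h : x.1 + e1 μ ∈ Box d fr.ℓ m.k m.M) (y' : ↥m.Ω₀T) (v : ι → ℝ) :
    siteNorm (dKer d fr.F (κS fr.ℓ m.k m.e) fr.ℓ m.k m.M
        (constBond (A0S d m.AcP m.x₀) Subtype.val + AprS d fr.ℓ m.k m.M (A0S d m.AcP m.x₀) m.AcP) m.KΩT μ x h y' *ᵥ v)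
      ≤ fr.cO * Real.exp (-(fr.δO * m.dLT x y')) * siteNorm v := by
  obtain ⟨hak0, hak1⟩ := m.ak_bounds
  have hmem : twrap ((fr.ℓ + 1) ^ m.instOT.k) m.instOT.P ((m.ET x).1 + e1 μ)
      ∈ fineDom ((fr.ℓ + 1) ^ m.instOT.k) m.instOT.ΩT :=
    twrap_boxEmb_add_e1_mem fr.ℓ m.k m.M m.o m.hΩP m.hbox μ x h
  have hv := siteNorm_nonneg v
  rw [constBond_add_AprS, dKer_KΩT_mulVec, siteNorm_smul, abs_of_pos hak0]
  by_cases hrect : fineDom ((fr.ℓ + 1) ^ m.k) m.Ω₀T = boxDom (per ((fr.ℓ + 1) ^ m.k) m.P)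
  · obtain ⟨hdR, hcR, -, H⟩ := R_spec fr.F fr.hℓ₁ fr.hLip d fr.ℓ fr.hℓ fr.amin fr.aplus fr.m2plus fr.ha fr.creg fr.β fr.hcreg fr.hβ
    have h2 := (H m.instOT m.instOT_regular m.instOT_bigBlocks m.he m.hleR hrect (m.ET x) y' v).2 μ hmem
    have he := m.exp_tldistO_le hdR.le fr.hδR x y'
    calc m.ak * siteNorm (fld (m.instOT.DT fr.F μ *ᵥ (m.instOT.GT fr.F *ᵥ tsrc fr.F m.instOT y' v)) (m.ET x))
        ≤ fr.aplus * (fr.cR1 * (Real.exp fr.dR1 * Real.exp (-(fr.δO * m.dLT x y'))) * siteNorm v) := by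
          refine mul_le_mul hak1 (h2.trans ?_) (siteNorm_nonneg _) fr.aplus_pos.le
          exact mul_le_mul_of_nonneg_right (mul_le_mul_of_nonneg_left he hcR.le) hv
      _ = (fr.aplus * fr.cR1 * Real.exp fr.dR1) * (Real.exp (-(fr.δO * m.dLT x y')) * siteNorm v) := by ring
      _ ≤ fr.cO * (Real.exp (-(fr.δO * m.dLT x y')) * siteNorm v) := mul_le_mul_of_nonneg_right fr.hcR (by positivity)
      _ = fr.cO * Real.exp (-(fr.δO * m.dLT x y')) * siteNorm v := by ring
  · have hne : (boxDom (per ((fr.ℓ + 1) ^ m.k) m.P) \ fineDom ((fr.ℓ + 1) ^ m.k) m.Ω₀T).Nonempty := by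
      rw [Finset.sdiff_nonempty]
      intro hsub'
      exact hrect (Finset.Subset.antisymm (fun z hz => val_mem_perBox (hnk fr.ℓ m.k) m.hΩP ⟨z, hz⟩) hsub')
    obtain ⟨hdT, hcT, -, -, H⟩ := T_spec fr.F fr.hℓ₁ fr.hLip d fr.ℓ fr.hℓ fr.amin fr.aplus fr.m2plus fr.ha fr.creg fr.β fr.hcreg fr.hβ
    have h2 := (H m.instOT m.instOT_regular m.instOT_bigBlocks m.he m.hleT (m.ET x) y' v
      (m.hRT.trans (m.R_le_tcdistO x hx hne))).2.1 μ hmem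
    have he := m.exp_tldistO_le hdT.le fr.hδT x y'
    calc m.ak * siteNorm (fld (m.instOT.DT fr.F μ *ᵥ (m.instOT.GT fr.F *ᵥ tsrc fr.F m.instOT y' v)) (m.ET x))
        ≤ fr.aplus * (fr.cT1 * (Real.exp fr.dT1 * Real.exp (-(fr.δO * m.dLT x y'))) * siteNorm v) := by
          refine mul_le_mul hak1 (h2.trans ?_) (siteNorm_nonneg _) fr.aplus_pos.le
          exact mul_le_mul_of_nonneg_right (mul_le_mul_of_nonneg_left he hcT.le) hv
      _ = (fr.aplus * fr.cT1 * Real.exp fr.dT1) * (Real.exp (-(fr.δO * m.dLT x y')) * siteNorm v) := by ring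
      _ ≤ fr.cO * (Real.exp (-(fr.δO * m.dLT x y')) * siteNorm v) := mul_le_mul_of_nonneg_right fr.hcT (by positivity)
      _ = fr.cO * Real.exp (-(fr.δO * m.dLT x y')) * siteNorm v := by ring

/-- **(2.58) FOR `D^η_AδG_k(□,Ω,A^{(k)})Q_k^*(A^{(k)})` ON THE TORUS — THE FIELD `dkerΩ_near` PROVED**.
[cite: Balaban1982Higgs2, Prop. 2.2 p. 571 «D^η_AδG_k(Ω, Ω₀, A)Q_k^*(A) … with the additional factor», (2.67) p. 572] -/
theorem dkerΩ_near (μ : Fin (d + 1)) (x : ↥(Box d fr.ℓ m.k m.M)) (hx : blkSite d fr.ℓ m.k m.M x = m.y)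
    (h : x.1 + e1 μ ∈ Box d fr.ℓ m.k m.M) (y' : ↥(boxDom m.M)) (v : ι → ℝ) :
    siteNorm ((dKer d fr.F (κS fr.ℓ m.k m.e) fr.ℓ m.k m.M
        (constBond (A0S d m.AcP m.x₀) Subtype.val + AprS d fr.ℓ m.k m.M (A0S d m.AcP m.x₀) m.AcP) m.KΩT μ x h (m.incT y')
      - dkerBox d fr.F (κS fr.ℓ m.k m.e) fr.ℓ m.k m.a m.m2 m.M (embS d fr.ℓ m.k m.M) (ΓS d fr.ℓ m.k m.M)
          (A0S d m.AcP m.x₀) (AprS d fr.ℓ m.k m.M (A0S d m.AcP m.x₀) m.AcP) μ x y') *ᵥ v)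
      ≤ fr.cO * Real.exp (-(fr.δO * m.R₄)) * Real.exp (-(fr.δO * m.dLT x (m.incT y'))) * siteNorm v := by
  obtain ⟨hak0, hak1⟩ := m.ak_bounds
  obtain ⟨hdT, hcT, -, -, H⟩ := T_spec fr.F fr.hℓ₁ fr.hLip d fr.ℓ fr.hℓ fr.amin fr.aplus fr.m2plus fr.ha fr.creg fr.β fr.hcreg fr.hβ
  have hmem : twrap ((fr.ℓ + 1) ^ m.instIT.k) m.instIT.P ((eB fr.ℓ m.k m.M m.o x).1 + e1 μ)
      ∈ fineDom ((fr.ℓ + 1) ^ m.instIT.k) m.instIT.ΩT :=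
    twrap_boxEmb_add_e1_mem fr.ℓ m.k m.M m.o (boxLabels_subset_boxDom m.ho0 m.hoP) (shift_mem_boxLabels m.M m.o) μ x h
  have h4 := (H m.instIT m.instIT_regular m.instIT_bigBlocks m.he m.hleT (eB fr.ℓ m.k m.M m.o x) (eY m.M m.o y') v
    (m.hRT.trans (m.R_le_tcdistI x hx))).2.2.2 μ hmem
  have hv := siteNorm_nonneg v
  have he := m.exp_tldistI_le hdT.le fr.hδT x y'
  have hc := m.exp_tcdist_le x hx y'
  rw [dKer_sub_dkerBox_mulVec, B4Lemma22PertVSup.siteNorm_neg, siteNorm_smul, abs_of_pos hak0]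
  calc m.ak * siteNorm (fld (m.instIT.DT fr.F μ *ᵥ m.instIT.deltaT fr.F
          (tsrc fr.F m.instIT (eY m.M m.o y') v)) (eB fr.ℓ m.k m.M m.o x))
      ≤ fr.aplus * (fr.cT1 * (Real.exp fr.dT1 * Real.exp (-(fr.δO * m.dLT x (m.incT y'))))
          * Real.exp (-(fr.δO * m.R₄)) * siteNorm v) := by
        refine mul_le_mul hak1 (h4.trans ?_) (siteNorm_nonneg _) fr.aplus_pos.le
        refine mul_le_mul (mul_le_mul (mul_le_mul_of_nonneg_left he hcT.le) hc (Real.exp_pos _).le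
          (by positivity)) le_rfl hv (by positivity)
    _ = (fr.aplus * fr.cT1 * Real.exp fr.dT1)
          * (Real.exp (-(fr.δO * m.R₄)) * Real.exp (-(fr.δO * m.dLT x (m.incT y'))) * siteNorm v) := by ring
    _ ≤ fr.cO * (Real.exp (-(fr.δO * m.R₄)) * Real.exp (-(fr.δO * m.dLT x (m.incT y'))) * siteNorm v) :=
        mul_le_mul_of_nonneg_right fr.hcT (by positivity)
    _ = fr.cO * Real.exp (-(fr.δO * m.R₄)) * Real.exp (-(fr.δO * m.dLT x (m.incT y'))) * siteNorm v := by ring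

/-! ### The lattice sum over the outer sites of the torus -/

/-- **`Σ_{y′ ∈ Tout} e^{−(δO/2)|y(x)+o−y′|_{T_1}} ≤ SO`** — THE FIELD `summableΩ` PROVED on the torus (nearest lifts + b05's
uniform lattice sums, `torus_latticeSum_le`). [cite: Balaban1983RegularityDecay, (2.39) p. 582 with its clause «Σ_{x∈Z^d} e^{−δ₀|x|}» p. 583, p. 572 «periodic conditions»] -/
theorem summableΩ (x : ↥(Box d fr.ℓ m.k m.M)) : ∑ y' ∈ m.Tout, Real.exp (-(fr.δO / 2 * m.dLT x y')) ≤ fr.SO := by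
  have hδ : 0 < fr.δO / 2 := half_pos fr.δO_pos
  refine le_trans ?_ fr.hST
  set b : Fin (d + 1) → ℤ := (blkSite d fr.ℓ m.k m.M x).1 + m.o with hb
  have hT : m.Tout.map ⟨Subtype.val, Subtype.val_injective⟩ ⊆ boxDom m.P := by
    intro z hz
    obtain ⟨y', -, rfl⟩ := Finset.mem_map.1 hz
    exact m.hΩP y'.2
  calc ∑ y' ∈ m.Tout, Real.exp (-(fr.δO / 2 * m.dLT x y'))
      = ∑ z ∈ m.Tout.map ⟨Subtype.val, Subtype.val_injective⟩, Real.exp (-(fr.δO / 2 * tnorm 1 m.P (b - z))) := by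
        rw [Finset.sum_map]; rfl
    _ ≤ B4Sect5Proof.latticeConst (d + 1) (fr.δO / 2) := torus_latticeSum_le m.hPT hδ _ hT b

/-! ### The `ModelT` instance and row B2.Lem2.4 for the torus family -/

/-- **THE `ModelT` INSTANCE OF A TORUS INSTANCE**: `KΩ :=` the torus kernel, `dΩ :=` the torus label distance, `inc :=` the
label embedding, `φ := φ ∘ inc`, `Ac :=` the translated periodic field; `kerΩ_far`, `kerΩ_near`, `dkerΩ_far`, `dkerΩ_near`,
`summableΩ`, `dΩ_nonneg`, `inc_inj`, `φΩ_inc` := the theorems. [cite: Balaban1982Higgs2, Lemma 2.4 p. 572, (2.56) p. 570, (2.58) pp. 570–571] -/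
def toModelT : ModelT fr.toFrameS ↥m.Ω₀T where
  k := m.k
  hk := m.hk
  a := m.a
  m2 := m.m2
  ha1 := m.ha1
  ha2 := m.ha2
  hm1 := m.hm1
  hm2 := m.hm2
  M := m.M
  hM := m.hM
  hMS := m.hMS
  hM3 := m.hM3
  e := m.e
  he := m.he
  hle := m.hle
  hθ1 := m.hθ1
  hτ1 := m.hτ1
  Ac := m.AcP
  hreg := m.hreg_box
  x₀ := m.x₀
  y := m.y
  sq1 := m.sq1
  y_mem := m.y_mem
  φ := fun y' => m.φΩ (m.incT y')
  p := m.p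
  q := m.q
  tφ := m.tφ
  R₁ := m.R₁
  R₂ := m.R₂
  R₄ := m.R₄
  p_nonneg := m.p_nonneg
  q_nonneg := m.q_nonneg
  tφ_nonneg := m.tφ_nonneg
  R₂_nonneg := m.R₂_nonneg
  q_le := m.q_le
  kap := m.kap
  sepG := m.sepG
  sepD := m.sepD
  sepO₂ := m.sepO₂
  sepO₄ := m.sepO₄
  θ_scale := m.θ_scale
  τ_scale := m.τ_scale
  θ'_scale := m.θ'_scale
  far1 := m.far1
  Tout := m.Tout
  inc := m.incT
  inc_inj := boxEmbY_injective m.M m.o m.hbox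
  inc_mem := m.inc_mem
  KΩ := m.KΩT
  φΩ := m.φΩ
  φΩ_inc := fun _ _ => rfl
  dΩ := m.dLT
  dΩ_nonneg := m.dLT_nonneg
  summableΩ := m.summableΩ
  kerΩ_far := fun x hx y' _ _ v => m.kerΩ_far x hx y' v
  farΩ := m.farΩ
  kerΩ_near := fun x hx y' _ v => m.kerΩ_near x hx y' v
  dkerΩ_far := fun μ x hx h y' _ _ v => m.dkerΩ_far μ x hx h y' v
  dkerΩ_near := fun μ x hx h y' _ v => m.dkerΩ_near μ x hx h y' v
  R := m.R
  hR1 := m.hR1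
  deep := m.deep

end ModelV

/-- the row's carrier filled by a torus instance: that of the built `ModelT` (restrictions (2.55), the three suprema of
(2.65)/(2.66) of the GENUINE outer field `φ^{(k)} = a_kG_k(Ω,A^{(k)})Q_k^*(A^{(k)})φ` of (2.56) on `Ω ⊂ T_η`, the scale
`p(L^kε)`). [cite: Balaban1982Higgs2, Lemma 2.4 (2.65)–(2.66) p. 572, (2.56) p. 570] -/
def famOfV (fr : FrameV ι d) (m : ModelV fr) : B2.L24Setting := famOfT fr.toFrameS ↥m.Ω₀T m.toModelT

/-- **ROW B2.Lem2.4 — LEMMA 2.4 (2.65)–(2.66), THE DECL OF RECORD `B2.Lemma24Printed`, FOR THE TORUS FAMILY WHOSE FOUR (2.58)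
KERNEL INPUTS ARE THEOREMS** (outer region `Ω = B^k(Λ₂′) ⊂ T_η` any union of big blocks, the whole torus included): one
constant `C` per frame and `dev265a, dev265b, dev266 ≤ C·p(L^kε)` for every instance obeying (2.55) — `lemma24_bounds
fr.toFrame` along `toModelT ∘ toModelS ∘ toModelR ∘ toModel`.  `C` is obtained BEFORE the instance `m` is introduced: a
function of `fr.toFrame` only (no torus size `P`, no `Ω₀T`/`Tout`, no `k`, `M`, `S`, `A`, `φ`, `e`; HONEST SCOPE (d)).
[cite: Balaban1982Higgs2, Lemma 2.4 (2.65)–(2.66) p. 572; proof (2.67)–(2.77) pp. 572–574; Prop. 2.2 (2.58) pp. 570–571]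
[cite: Balaban1983RegularityDecay, Theorem p. 573, p. 572 «operators on subsets of a torus T_η»] -/
theorem lemma24Printed_modelV (fr : FrameV ι d) : B2.Lemma24Printed (famOfV fr) := by
  obtain ⟨C, -, h⟩ := lemma24_bounds fr.toFrame
  refine ⟨C, fun m hR => ?_⟩
  have hR' : m.toModelT.toModelS.toModelR.Restr := hR
  obtain ⟨h1, h2, h3⟩ := h _ (m.toModelT.toModelS.toModelR.toModel hR') (m.toModelT.toModelS.toModelR.toModel_restr hR')
  obtain ⟨e1, e2, e3⟩ := m.toModelT.toModelS.toModelR.toModel_dev hR'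
  refine ⟨?_, ?_, ?_⟩
  · show m.toModelT.toModelS.toModelR.dev265a ≤ C * m.p
    rw [← e1]; exact h1
  · show m.toModelT.toModelS.toModelR.dev265b ≤ C * m.p
    rw [← e2]; exact h2
  · show m.toModelT.toModelS.toModelR.dev266 ≤ C * m.p
    rw [← e3]; exact h3

end Instance


end

end Literature.MathematicalPhysics.QuantumFieldTheory.Balaban1983to89.B2Lemma24KerOmegaTorus
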